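import Mathlib
import HarnessLib
import Literature.Analysis.FluidPDE.VorticityCalculus
import Literature.Analysis.FluidPDE.VectorCalculusProofs
import Literature.Analysis.FluidPDE.SectionalCirculation
import Literature.Analysis.FunctionSpaces.SmoothParametricIntegral

/-!
# Lei–Ren–Tian 2025, §3 (3.2)–(3.3): the flipped vorticity is divergence free under the slack-free
# cone, so the absolute vorticity flux through horizontal discs is controlled by the lateral flux

Analysis/FluidPDE proofs-only file (no definitions, no named facts; piece X_FluxM0 of the «needs X» map of the
INPUT `LeiRenTian2025_doubleCone_regularity`, `VorticityDoubleConeRegularity.lean`). Pure calculus, the "key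
observation" of Z. Lei, X. Ren, G. Tian, *A geometric characterization of potential Navier–Stokes singularities*,
arXiv:2501.08976, p. 8, which is also the `M = 0` substitute for their Lemma 3.1 that §4's (4.1) consumes after
blow-up: for a `C²` vector field `w` on `ℝ³` whose vorticity `ω = curl w` satisfies the SLACK-FREE CONE
`|ω| ≤ C |ω₃|` on the solid cylinder `{|x_h| ≤ a, z₁ ≤ x₃ ≤ z₂}`, the absolute fluxes
`Γ(a, z) = ∫_{D(a,z)} |ω₃| dx_h` through the two lids differ by at most the lateral integral of `|ω|`:

  `|Γ(a, z₂) − Γ(a, z₁)| ≤ ∫_{z₁}^{z₂} ∫₀^{2π} |ω(a cos θ, a sin θ, ζ)| a dθ dζ`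

(`LeiRenTian2025.FlippedVorticity.absFlux_sub_absFlux_le`).  Printed mechanism ((3.2)–(3.3)): the flipped vorticity
`ω̃ = sgn(ω₃) ω` is divergence free in the weak sense (regularise by `ω̃^{(ε)} = ω₃ ω/√(ω₃² + ε²)`, whose
divergence `ε² (ω·∇ω₃)/(ω₃²+ε²)^{3/2}` is bounded under the cone and tends to `0` pointwise), and the divergence
private theorem on the solid cylinder gives `∫_{D(a,z)} |ω₃| = ∫_{D(a,a)} ω̃₃ + ∫∫_S ω̃·e_r`.  Here, in differentiated /
polar form (no measure theory on discs): `g_ε(s) = √(s²+ε²)`, `V_ε = g_ε'(ω₃) ω`; the polar divergence theorem on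
circles (`hasDerivAt_radialFlux`, `discIntegral_divH_eq_radialFlux`: `∂ᵣ(r V_r) + ∂_θ V_θ = r div_h V`); the
pointwise identity `div_h V_ε = E_ε − ∂₃ g_ε(ω₃)` (`divH_flipped_eq`, with `div curl = 0`); the fundamental theorem
of calculus along vertical lines; Fubini for continuous integrands on boxes; dominated convergence as `ε → 0⁺`
(`|E_ε| ≤ 2C‖∇ω‖`, `E_ε → 0`).  Cylindrical points are the accepted `meridionalPoint θ r z = (r cos θ, r sin θ, z)`
(`SectionalCirculation.lean`), the axial vector is the accepted `eZ` (`AxisymmetricEuler.lean`).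

WHAT THIS IS NOT: nothing about Navier–Stokes regularity is proved or claimed, and the INPUT
`LeiRenTian2025_doubleCone_regularity` is NOT discharged by this file (see the seat's «needs X» note, evidence
20260828T194110Z on stmt-NavierStokesRegularity-0155).

## References

* Z. Lei, X. Ren, G. Tian, arXiv:2501.08976 (2025), §3, displays (3.2)–(3.3), p. 8. [LeiRenTian2025]
* A. Majda, A. Bertozzi, *Vorticity and Incompressible Flow* (2002), §1.1 (`div curl = 0`). [MajdaBertozziCUP2002]
-/

noncomputable section

namespace Literature.Analysis.FluidPDE.LeiRenTian2025.FlippedVorticity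

open scoped Topology InnerProductSpace
open Set Function MeasureTheory intervalIntegral Filter
open Literature.Analysis Literature.Analysis.FunctionSpaces Literature.Analysis.FluidPDE

/-! ### The cylindrical frame `(r cos θ, r sin θ, z)`, `e_r(θ) = (cos θ, sin θ, 0)`, `e_θ(θ)`, `e_z` -/

/-- `(r cos θ, r sin θ, z) = cos θ • (r e₀) + sin θ • (r e₁) + z • e_z`. [folklore] -/
private theorem merid_eq_cos_sin (θ r z : ℝ) :
    meridionalPoint θ r z = Real.cos θ • (r • (EuclideanSpace.single (0 : Fin 3) (1 : ℝ)))
      + Real.sin θ • (r • (EuclideanSpace.single (1 : Fin 3) (1 : ℝ))) + z • eZ := by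
  ext i
  fin_cases i <;> simp [meridionalPoint, eZ] <;> ring

/-- `(r cos θ, r sin θ, z) = r • e_r(θ) + z • e_z`. [folklore] -/
private theorem merid_eq_smul_eR (θ r z : ℝ) :
    meridionalPoint θ r z = r • meridionalPoint θ 1 0 + z • eZ := by
  ext i
  fin_cases i <;> simp [meridionalPoint, eZ]

/-- `e_r(θ) = cos θ • e₀ + sin θ • e₁`. [folklore] -/
private theorem eR_eq (θ : ℝ) :
    meridionalPoint θ 1 0 = Real.cos θ • (EuclideanSpace.single (0 : Fin 3) (1 : ℝ))
      + Real.sin θ • (EuclideanSpace.single (1 : Fin 3) (1 : ℝ)) := by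
  ext i
  fin_cases i <;> simp [meridionalPoint]

/-- `e_θ(θ) = −sin θ • e₀ + cos θ • e₁`. [folklore] -/
private theorem eT_eq (θ : ℝ) :
    (WithLp.toLp 2 ![-Real.sin θ, Real.cos θ, 0] : EuclideanSpace ℝ (Fin 3)) =
      -Real.sin θ • (EuclideanSpace.single (0 : Fin 3) (1 : ℝ))
        + Real.cos θ • (EuclideanSpace.single (1 : Fin 3) (1 : ℝ)) := by
  ext i
  fin_cases i <;> simp

/-- `‖e_r(θ)‖ = 1`. [folklore] -/
private theorem norm_eR (θ : ℝ) : ‖meridionalPoint θ 1 0‖ = 1 := by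
  rw [EuclideanSpace.norm_eq, Fin.sum_univ_three]
  simp [meridionalPoint]

/-- The frame is `2π`-periodic. [folklore] -/
private theorem merid_two_pi (r z : ℝ) : meridionalPoint (2 * Real.pi) r z = meridionalPoint 0 r z := by
  simp [meridionalPoint]

/-- `θ ↦ e_r(θ)` is continuous. [folklore] -/
private theorem continuous_eR : Continuous fun θ : ℝ => meridionalPoint θ 1 0 := by
  rw [show (fun θ : ℝ => meridionalPoint θ 1 0) = fun θ => Real.cos θ • (EuclideanSpace.single (0 : Fin 3) (1 : ℝ))
      + Real.sin θ • (EuclideanSpace.single (1 : Fin 3) (1 : ℝ)) from funext eR_eq]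
  fun_prop

/-- `θ ↦ e_θ(θ)` is continuous. [folklore] -/
private theorem continuous_eT : Continuous fun θ : ℝ =>
    (WithLp.toLp 2 ![-Real.sin θ, Real.cos θ, 0] : EuclideanSpace ℝ (Fin 3)) := by
  rw [show (fun θ : ℝ => (WithLp.toLp 2 ![-Real.sin θ, Real.cos θ, 0] : EuclideanSpace ℝ (Fin 3))) =
      fun θ => -Real.sin θ • (EuclideanSpace.single (0 : Fin 3) (1 : ℝ))
        + Real.cos θ • (EuclideanSpace.single (1 : Fin 3) (1 : ℝ)) from funext eT_eq]
  fun_prop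

/-- `θ ↦ e_r(θ)` is smooth. [folklore] -/
private theorem contDiff_eR {n : WithTop ℕ∞} : ContDiff ℝ n fun θ : ℝ => meridionalPoint θ 1 0 := by
  rw [show (fun θ : ℝ => meridionalPoint θ 1 0) = fun θ => Real.cos θ • (EuclideanSpace.single (0 : Fin 3) (1 : ℝ))
      + Real.sin θ • (EuclideanSpace.single (1 : Fin 3) (1 : ℝ)) from funext eR_eq]
  fun_prop

/-- `θ ↦ e_θ(θ)` is smooth. [folklore] -/
private theorem contDiff_eT {n : WithTop ℕ∞} : ContDiff ℝ n fun θ : ℝ =>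
    (WithLp.toLp 2 ![-Real.sin θ, Real.cos θ, 0] : EuclideanSpace ℝ (Fin 3)) := by
  rw [show (fun θ : ℝ => (WithLp.toLp 2 ![-Real.sin θ, Real.cos θ, 0] : EuclideanSpace ℝ (Fin 3))) =
      fun θ => -Real.sin θ • (EuclideanSpace.single (0 : Fin 3) (1 : ℝ))
        + Real.cos θ • (EuclideanSpace.single (1 : Fin 3) (1 : ℝ)) from funext eT_eq]
  fun_prop

/-- `(θ, r) ↦ (r cos θ, r sin θ, z)` is smooth on `ℝ × ℝ`. [folklore] -/
private theorem contDiff_merid₂ (z : ℝ) {n : WithTop ℕ∞} :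
    ContDiff ℝ n (fun q : ℝ × ℝ => meridionalPoint q.1 q.2 z) := by
  have h : (fun q : ℝ × ℝ => meridionalPoint q.1 q.2 z) = fun q : ℝ × ℝ =>
      Real.cos q.1 • (q.2 • (EuclideanSpace.single (0 : Fin 3) (1 : ℝ)))
        + Real.sin q.1 • (q.2 • (EuclideanSpace.single (1 : Fin 3) (1 : ℝ))) + z • eZ :=
    funext fun q => merid_eq_cos_sin q.1 q.2 z
  rw [h]
  fun_prop

/-- `(r, θ, z) ↦ (r cos θ, r sin θ, z)` is smooth on `ℝ × ℝ × ℝ`. [folklore] -/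
private theorem contDiff_merid₃ {n : WithTop ℕ∞} :
    ContDiff ℝ n (fun q : ℝ × ℝ × ℝ => meridionalPoint q.2.1 q.1 q.2.2) := by
  have h : (fun q : ℝ × ℝ × ℝ => meridionalPoint q.2.1 q.1 q.2.2) = fun q : ℝ × ℝ × ℝ =>
      Real.cos q.2.1 • (q.1 • (EuclideanSpace.single (0 : Fin 3) (1 : ℝ)))
        + Real.sin q.2.1 • (q.1 • (EuclideanSpace.single (1 : Fin 3) (1 : ℝ))) + q.2.2 • eZ :=
    funext fun q => merid_eq_cos_sin q.2.1 q.1 q.2.2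
  rw [h]
  fun_prop

/-- Continuity of `(r, θ, z) ↦ (r cos θ, r sin θ, z)`. [folklore] -/
private theorem continuous_merid₃ : Continuous (fun q : ℝ × ℝ × ℝ => meridionalPoint q.2.1 q.1 q.2.2) :=
  (contDiff_merid₃ (n := 0)).continuous

/-- `∂ᵣ (r cos θ, r sin θ, z) = e_r(θ)`. [folklore] -/
private theorem hasDerivAt_merid_r (r θ z : ℝ) :
    HasDerivAt (fun r' => meridionalPoint θ r' z) (meridionalPoint θ 1 0) r := by
  rw [show (fun r' => meridionalPoint θ r' z) = fun r' => r' • meridionalPoint θ 1 0 + z • eZ from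
    funext fun r' => merid_eq_smul_eR θ r' z]
  simpa using ((hasDerivAt_id r).smul_const (meridionalPoint θ 1 0)).add_const (z • eZ)

/-- `∂_θ (r cos θ, r sin θ, z) = r • e_θ(θ)`. [folklore] -/
private theorem hasDerivAt_merid_theta (r θ z : ℝ) :
    HasDerivAt (fun θ' => meridionalPoint θ' r z)
      (r • (WithLp.toLp 2 ![-Real.sin θ, Real.cos θ, 0] : EuclideanSpace ℝ (Fin 3))) θ := by
  rw [show (fun θ' => meridionalPoint θ' r z) = fun θ' =>
      Real.cos θ' • (r • (EuclideanSpace.single (0 : Fin 3) (1 : ℝ)))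
        + Real.sin θ' • (r • (EuclideanSpace.single (1 : Fin 3) (1 : ℝ))) + z • eZ from
    funext fun θ' => merid_eq_cos_sin θ' r z]
  have h := (((Real.hasDerivAt_cos θ).smul_const (r • (EuclideanSpace.single (0 : Fin 3) (1 : ℝ)))).add
    ((Real.hasDerivAt_sin θ).smul_const (r • (EuclideanSpace.single (1 : Fin 3) (1 : ℝ))))).add_const (z • eZ)
  refine h.congr_deriv ?_
  ext i
  fin_cases i <;> simp <;> ring

/-- `∂_z (r cos θ, r sin θ, z) = e_z`. [folklore] -/
private theorem hasDerivAt_merid_z (r θ z : ℝ) : HasDerivAt (fun z' => meridionalPoint θ r z') eZ z := by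
  rw [show (fun z' => meridionalPoint θ r z') = fun z' => r • meridionalPoint θ 1 0 + z' • eZ from
    funext fun z' => merid_eq_smul_eR θ r z']
  simpa using ((hasDerivAt_id z).smul_const eZ).const_add (r • meridionalPoint θ 1 0)

/-- `∂_θ e_r = e_θ`. [folklore] -/
private theorem hasDerivAt_eR (θ : ℝ) :
    HasDerivAt (fun θ' : ℝ => meridionalPoint θ' 1 0)
      (WithLp.toLp 2 ![-Real.sin θ, Real.cos θ, 0] : EuclideanSpace ℝ (Fin 3)) θ := by
  rw [show (fun θ' : ℝ => meridionalPoint θ' 1 0) = fun θ => Real.cos θ • (EuclideanSpace.single (0 : Fin 3) (1 : ℝ))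
      + Real.sin θ • (EuclideanSpace.single (1 : Fin 3) (1 : ℝ)) from funext eR_eq]
  have h := ((Real.hasDerivAt_cos θ).smul_const (EuclideanSpace.single (0 : Fin 3) (1 : ℝ))).add
    ((Real.hasDerivAt_sin θ).smul_const (EuclideanSpace.single (1 : Fin 3) (1 : ℝ)))
  refine h.congr_deriv ?_
  ext i
  fin_cases i <;> simp

/-- `∂_θ e_θ = −e_r`. [folklore] -/
private theorem hasDerivAt_eT (θ : ℝ) :
    HasDerivAt (fun θ' : ℝ => (WithLp.toLp 2 ![-Real.sin θ', Real.cos θ', 0] : EuclideanSpace ℝ (Fin 3)))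
      (-meridionalPoint θ 1 0) θ := by
  rw [show (fun θ' : ℝ => (WithLp.toLp 2 ![-Real.sin θ', Real.cos θ', 0] : EuclideanSpace ℝ (Fin 3))) =
      fun θ => -Real.sin θ • (EuclideanSpace.single (0 : Fin 3) (1 : ℝ))
        + Real.cos θ • (EuclideanSpace.single (1 : Fin 3) (1 : ℝ)) from funext eT_eq]
  have h := ((Real.hasDerivAt_sin θ).neg.smul_const (EuclideanSpace.single (0 : Fin 3) (1 : ℝ))).add
    ((Real.hasDerivAt_cos θ).smul_const (EuclideanSpace.single (1 : Fin 3) (1 : ℝ)))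
  refine h.congr_deriv ?_
  ext i
  fin_cases i <;> simp [meridionalPoint]

/-! ### The polar divergence theorem on circles

For a `C¹` field `V` on `ℝ³` write `div_h V = ∂₀V₀ + ∂₁V₁` (horizontal divergence).  Then
`d/dr ∫₀^{2π} ⟪V(meridionalPoint θ r z), e_r⟫ r dθ = ∫₀^{2π} div_h V (meridionalPoint θ r z) r dθ`, from the pointwise identity
`∂ᵣ(r V_r) + ∂_θ V_θ = r div_h V` and periodicity — the twin of the tree's Stokes-on-circles computation (route AxisTwistDoor) with
`(e_θ, curl)` replaced by `(e_r, div_h)`. -/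

variable {V : EuclideanSpace ℝ (Fin 3) → EuclideanSpace ℝ (Fin 3)}

/-- `∂ᵣ [⟪V(meridionalPoint θ r z), e_r⟫ r] = ⟪DV(meridionalPoint θ r z) e_r, e_r⟫ r + ⟪V(meridionalPoint θ r z), e_r⟫`. [folklore] -/
private theorem hasDerivAt_radial_r (hV : ContDiff ℝ 1 V) (r θ z : ℝ) :
    HasDerivAt (fun r' => ⟪V (meridionalPoint θ r' z), meridionalPoint θ 1 0⟫_ℝ * r')
      (⟪fderiv ℝ V (meridionalPoint θ r z) (meridionalPoint θ 1 0), meridionalPoint θ 1 0⟫_ℝ * r + ⟪V (meridionalPoint θ r z), meridionalPoint θ 1 0⟫_ℝ) r := by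
  have h1 : HasDerivAt (fun r' => V (meridionalPoint θ r' z)) (fderiv ℝ V (meridionalPoint θ r z) (meridionalPoint θ 1 0)) r :=
    ((hV.differentiable one_ne_zero) _).hasFDerivAt.comp_hasDerivAt r (hasDerivAt_merid_r r θ z)
  have h2 : HasDerivAt (fun r' => ⟪V (meridionalPoint θ r' z), meridionalPoint θ 1 0⟫_ℝ)
      (⟪fderiv ℝ V (meridionalPoint θ r z) (meridionalPoint θ 1 0), meridionalPoint θ 1 0⟫_ℝ) r := by
    simpa using h1.inner ℝ (hasDerivAt_const r (meridionalPoint θ 1 0))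
  have h3 : HasDerivAt (fun r' => ⟪V (meridionalPoint θ r' z), meridionalPoint θ 1 0⟫_ℝ * r')
      (⟪fderiv ℝ V (meridionalPoint θ r z) (meridionalPoint θ 1 0), meridionalPoint θ 1 0⟫_ℝ * id r + ⟪V (meridionalPoint θ r z), meridionalPoint θ 1 0⟫_ℝ * 1) r :=
    h2.mul (hasDerivAt_id r)
  simpa using h3

/-- `∂_θ ⟪V(meridionalPoint θ r z), e_θ(θ)⟫ = ⟪DV(meridionalPoint θ r z)(r e_θ), e_θ⟫ − ⟪V(meridionalPoint θ r z), e_r⟫`. [folklore] -/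
private theorem hasDerivAt_azimuthal_theta (hV : ContDiff ℝ 1 V) (r θ z : ℝ) :
    HasDerivAt (fun θ' => ⟪V (meridionalPoint θ' r z), (WithLp.toLp 2 ![-Real.sin θ', Real.cos θ', 0] : EuclideanSpace ℝ (Fin 3))⟫_ℝ)
      (⟪fderiv ℝ V (meridionalPoint θ r z) (r • (WithLp.toLp 2 ![-Real.sin θ, Real.cos θ, 0] : EuclideanSpace ℝ (Fin 3))), (WithLp.toLp 2 ![-Real.sin θ, Real.cos θ, 0] : EuclideanSpace ℝ (Fin 3))⟫_ℝ - ⟪V (meridionalPoint θ r z), meridionalPoint θ 1 0⟫_ℝ) θ := by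
  have h1 : HasDerivAt (fun θ' => V (meridionalPoint θ' r z)) (fderiv ℝ V (meridionalPoint θ r z) (r • (WithLp.toLp 2 ![-Real.sin θ, Real.cos θ, 0] : EuclideanSpace ℝ (Fin 3)))) θ :=
    ((hV.differentiable one_ne_zero) _).hasFDerivAt.comp_hasDerivAt θ (hasDerivAt_merid_theta r θ z)
  have h2 := h1.inner ℝ (hasDerivAt_eT θ)
  refine h2.congr_deriv ?_
  rw [inner_neg_right]
  ring

/-- The horizontal divergence `div_h V (x) = ∂₀V₀ + ∂₁V₁` as a rotation-invariant trace:
`⟪DV e_r, e_r⟫ + ⟪DV e_θ, e_θ⟫ = DV e₀ · e₀ + DV e₁ · e₁`. [folklore] -/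
private theorem horizontal_trace (L : EuclideanSpace ℝ (Fin 3) →L[ℝ] EuclideanSpace ℝ (Fin 3)) (θ : ℝ) :
    ⟪L (meridionalPoint θ 1 0), meridionalPoint θ 1 0⟫_ℝ + ⟪L ((WithLp.toLp 2 ![-Real.sin θ, Real.cos θ, 0] : EuclideanSpace ℝ (Fin 3))), (WithLp.toLp 2 ![-Real.sin θ, Real.cos θ, 0] : EuclideanSpace ℝ (Fin 3))⟫_ℝ =
      L (EuclideanSpace.single 0 1) 0 + L (EuclideanSpace.single 1 1) 1 := by
  rw [eR_eq, eT_eq]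
  simp only [map_add, map_smul, map_neg, inner_add_left, inner_add_right, inner_smul_left,
    inner_smul_right, inner_neg_left, inner_neg_right, neg_smul,
    EuclideanSpace.inner_single_right, RCLike.conj_to_real, map_smul]
  have h := Real.sin_sq_add_cos_sq θ
  set c := Real.cos θ
  set σ := Real.sin θ
  set a00 := L (EuclideanSpace.single (0 : Fin 3) (1 : ℝ)) 0
  set a01 := L (EuclideanSpace.single (0 : Fin 3) (1 : ℝ)) 1
  set a10 := L (EuclideanSpace.single (1 : Fin 3) (1 : ℝ)) 0
  set a11 := L (EuclideanSpace.single (1 : Fin 3) (1 : ℝ)) 1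
  linear_combination (a00 + a11) * h

/-- The KEY POINTWISE IDENTITY (divergence theorem in cylindrical components):
`∂ᵣ(r V_r) + ∂_θ V_θ = r div_h V`, i.e. with `L = DV(meridionalPoint θ r z)`:
`⟪L e_r, e_r⟫ r + ⟪V, e_r⟫ = (L e₀ · e₀ + L e₁ · e₁) r − (⟪L (r e_θ), e_θ⟫ − ⟪V, e_r⟫)`. [folklore] -/
private theorem key_identity_div (r θ z : ℝ) :
    ⟪fderiv ℝ V (meridionalPoint θ r z) (meridionalPoint θ 1 0), meridionalPoint θ 1 0⟫_ℝ * r + ⟪V (meridionalPoint θ r z), meridionalPoint θ 1 0⟫_ℝ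
      = (fderiv ℝ V (meridionalPoint θ r z) (EuclideanSpace.single 0 1) 0
          + fderiv ℝ V (meridionalPoint θ r z) (EuclideanSpace.single 1 1) 1) * r
        - (⟪fderiv ℝ V (meridionalPoint θ r z) (r • (WithLp.toLp 2 ![-Real.sin θ, Real.cos θ, 0] : EuclideanSpace ℝ (Fin 3))), (WithLp.toLp 2 ![-Real.sin θ, Real.cos θ, 0] : EuclideanSpace ℝ (Fin 3))⟫_ℝ - ⟪V (meridionalPoint θ r z), meridionalPoint θ 1 0⟫_ℝ) := by
  rw [← horizontal_trace (fderiv ℝ V (meridionalPoint θ r z)) θ, map_smul, inner_smul_left]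
  simp only [RCLike.conj_to_real]
  ring

/-- `θ ↦ ⟪DV(meridionalPoint θ r z)(r e_θ), e_θ⟫ − ⟪V(meridionalPoint θ r z), e_r⟫` is continuous for `C¹` `V`. [folklore] -/
private theorem continuous_azimuthal_theta_deriv (hV : ContDiff ℝ 1 V) (r z : ℝ) :
    Continuous fun θ => ⟪fderiv ℝ V (meridionalPoint θ r z) (r • (WithLp.toLp 2 ![-Real.sin θ, Real.cos θ, 0] : EuclideanSpace ℝ (Fin 3))), (WithLp.toLp 2 ![-Real.sin θ, Real.cos θ, 0] : EuclideanSpace ℝ (Fin 3))⟫_ℝ - ⟪V (meridionalPoint θ r z), meridionalPoint θ 1 0⟫_ℝ := by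
  have hp : Continuous fun θ => meridionalPoint θ r z :=
    (contDiff_merid₂ z (n := 0)).continuous.comp (continuous_id.prodMk continuous_const)
  have h1 : Continuous fun θ => V (meridionalPoint θ r z) := hV.continuous.comp hp
  have h2 : Continuous fun θ => fderiv ℝ V (meridionalPoint θ r z) := (hV.continuous_fderiv one_ne_zero).comp hp
  exact ((h2.clm_apply (continuous_eT.const_smul r)).inner continuous_eT).sub (h1.inner continuous_eR)

/-- `∫₀^{2π} ∂_θ ⟪V(meridionalPoint θ r z), e_θ(θ)⟫ dθ = 0` (periodicity). [folklore] -/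
private theorem integral_azimuthal_theta_deriv_eq_zero (hV : ContDiff ℝ 1 V) (r z : ℝ) :
    ∫ θ in (0 : ℝ)..(2 * Real.pi),
      (⟪fderiv ℝ V (meridionalPoint θ r z) (r • (WithLp.toLp 2 ![-Real.sin θ, Real.cos θ, 0] : EuclideanSpace ℝ (Fin 3))), (WithLp.toLp 2 ![-Real.sin θ, Real.cos θ, 0] : EuclideanSpace ℝ (Fin 3))⟫_ℝ - ⟪V (meridionalPoint θ r z), meridionalPoint θ 1 0⟫_ℝ) = 0 := by
  rw [integral_eq_sub_of_hasDerivAt (fun θ _ => hasDerivAt_azimuthal_theta hV r θ z)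
    ((continuous_azimuthal_theta_deriv hV r z).intervalIntegrable _ _)]
  have h2 : (WithLp.toLp 2 ![-Real.sin (2 * Real.pi), Real.cos (2 * Real.pi), 0] : EuclideanSpace ℝ (Fin 3)) = (WithLp.toLp 2 ![-Real.sin 0, Real.cos 0, 0] : EuclideanSpace ℝ (Fin 3)) := by simp
  rw [merid_two_pi, h2, sub_self]

/-- The integrand `(θ, r') ↦ ⟪V(meridionalPoint θ r' z), e_r(θ)⟫ r'` is `C¹` jointly. [folklore] -/
private theorem contDiff_radial_integrand (hV : ContDiff ℝ 1 V) (z : ℝ) :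
    ContDiff ℝ 1 fun q : ℝ × ℝ => ⟪V (meridionalPoint q.1 q.2 z), meridionalPoint q.1 1 0⟫_ℝ * q.2 := by
  have h1 : ContDiff ℝ 1 fun q : ℝ × ℝ => V (meridionalPoint q.1 q.2 z) := hV.comp (contDiff_merid₂ z)
  have h2 : ContDiff ℝ 1 fun q : ℝ × ℝ => meridionalPoint q.1 1 0 := contDiff_eR.comp contDiff_fst
  exact (h1.inner ℝ h2).mul contDiff_snd

/-- The partial derivative of the radial integrand in `r'` is `⟪DV e_r, e_r⟫ r + ⟪V, e_r⟫`. [folklore] -/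
private theorem fderiv_radial_integrand_apply (hV : ContDiff ℝ 1 V) (z θ r : ℝ) :
    fderiv ℝ (fun q : ℝ × ℝ => ⟪V (meridionalPoint q.1 q.2 z), meridionalPoint q.1 1 0⟫_ℝ * q.2) (θ, r) ((0 : ℝ), (1 : ℝ))
      = ⟪fderiv ℝ V (meridionalPoint θ r z) (meridionalPoint θ 1 0), meridionalPoint θ 1 0⟫_ℝ * r + ⟪V (meridionalPoint θ r z), meridionalPoint θ 1 0⟫_ℝ := by
  have hH := contDiff_radial_integrand hV z
  have h1 : HasDerivAt (fun r' : ℝ => (fun q : ℝ × ℝ => ⟪V (meridionalPoint q.1 q.2 z), meridionalPoint q.1 1 0⟫_ℝ * q.2) (θ, r'))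
      (fderiv ℝ (fun q : ℝ × ℝ => ⟪V (meridionalPoint q.1 q.2 z), meridionalPoint q.1 1 0⟫_ℝ * q.2) (θ, r) ((0 : ℝ), (1 : ℝ))) r := by
    have hc : HasDerivAt (fun r' : ℝ => ((θ, r') : ℝ × ℝ)) ((0 : ℝ), (1 : ℝ)) r :=
      (hasDerivAt_const r θ).prodMk (hasDerivAt_id r)
    exact ((hH.differentiable one_ne_zero) (θ, r)).hasFDerivAt.comp_hasDerivAt r hc
  exact h1.unique (hasDerivAt_radial_r hV r θ z)

/-- **Polar divergence theorem on circles** for a `C¹` field: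
`d/dr ∫₀^{2π} ⟪V(meridionalPoint θ r z), e_r⟫ r dθ = ∫₀^{2π} div_h V (meridionalPoint θ r z) r dθ`, where
`div_h V (x) = DV(x) e₀ · e₀ + DV(x) e₁ · e₁`. [cite: LeiRenTian2025, §4 (4.3)–(4.4) (arXiv:2501.08976, p. 11: integration by parts in the horizontal variables over discs/circles)] -/
theorem hasDerivAt_radialFlux (hV : ContDiff ℝ 1 V) (r z : ℝ) :
    HasDerivAt (fun r' => ∫ θ in (0 : ℝ)..(2 * Real.pi), ⟪V (meridionalPoint θ r' z), meridionalPoint θ 1 0⟫_ℝ * r')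
      (∫ θ in (0 : ℝ)..(2 * Real.pi),
        (fderiv ℝ V (meridionalPoint θ r z) (EuclideanSpace.single 0 1) 0
          + fderiv ℝ V (meridionalPoint θ r z) (EuclideanSpace.single 1 1) 1) * r) r := by
  have hH := contDiff_radial_integrand hV z
  have hF : HasDerivAt (fun r' => ∫ θ in (0 : ℝ)..(2 * Real.pi), ⟪V (meridionalPoint θ r' z), meridionalPoint θ 1 0⟫_ℝ * r')
      (∫ θ in (0 : ℝ)..(2 * Real.pi),
        fderiv ℝ (fun q : ℝ × ℝ => ⟪V (meridionalPoint q.1 q.2 z), meridionalPoint q.1 1 0⟫_ℝ * q.2) (θ, r) ((0 : ℝ), (1 : ℝ))) r := by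
    have hd := (hasFDerivAt_parametric_intervalIntegral hH one_ne_zero 0 (2 * Real.pi) r).hasDerivAt
    rw [← fderiv_parametric_intervalIntegral_apply hH one_ne_zero 0 (2 * Real.pi) r 1,
      (hasFDerivAt_parametric_intervalIntegral hH one_ne_zero 0 (2 * Real.pi) r).fderiv]
    exact hd
  have hpt : ∀ θ : ℝ,
      fderiv ℝ (fun q : ℝ × ℝ => ⟪V (meridionalPoint q.1 q.2 z), meridionalPoint q.1 1 0⟫_ℝ * q.2) (θ, r) ((0 : ℝ), (1 : ℝ))
        = (fderiv ℝ V (meridionalPoint θ r z) (EuclideanSpace.single 0 1) 0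
            + fderiv ℝ V (meridionalPoint θ r z) (EuclideanSpace.single 1 1) 1) * r
          - (⟪fderiv ℝ V (meridionalPoint θ r z) (r • (WithLp.toLp 2 ![-Real.sin θ, Real.cos θ, 0] : EuclideanSpace ℝ (Fin 3))), (WithLp.toLp 2 ![-Real.sin θ, Real.cos θ, 0] : EuclideanSpace ℝ (Fin 3))⟫_ℝ - ⟪V (meridionalPoint θ r z), meridionalPoint θ 1 0⟫_ℝ) := fun θ => by
    rw [fderiv_radial_integrand_apply hV z θ r, key_identity_div]
  have hp : Continuous fun θ => meridionalPoint θ r z :=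
    (contDiff_merid₂ z (n := 0)).continuous.comp (continuous_id.prodMk continuous_const)
  have hD : Continuous fun θ => fderiv ℝ V (meridionalPoint θ r z) := (hV.continuous_fderiv one_ne_zero).comp hp
  have hdiv : Continuous fun θ => (fderiv ℝ V (meridionalPoint θ r z) (EuclideanSpace.single 0 1) 0
      + fderiv ℝ V (meridionalPoint θ r z) (EuclideanSpace.single 1 1) 1) * r := by
    have h0 : Continuous fun θ => fderiv ℝ V (meridionalPoint θ r z) (EuclideanSpace.single 0 1) :=
      hD.clm_apply continuous_const
    have h1 : Continuous fun θ => fderiv ℝ V (meridionalPoint θ r z) (EuclideanSpace.single 1 1) :=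
      hD.clm_apply continuous_const
    have hc0 : Continuous fun θ => fderiv ℝ V (meridionalPoint θ r z) (EuclideanSpace.single 0 1) 0 :=
      (EuclideanSpace.proj (0 : Fin 3) : EuclideanSpace ℝ (Fin 3) →L[ℝ] ℝ).continuous.comp h0
    have hc1 : Continuous fun θ => fderiv ℝ V (meridionalPoint θ r z) (EuclideanSpace.single 1 1) 1 :=
      (EuclideanSpace.proj (1 : Fin 3) : EuclideanSpace ℝ (Fin 3) →L[ℝ] ℝ).continuous.comp h1
    exact (hc0.add hc1).mul continuous_const
  rw [intervalIntegral.integral_congr (fun θ _ => hpt θ),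
    intervalIntegral.integral_sub (hdiv.intervalIntegrable _ _)
      ((continuous_azimuthal_theta_deriv hV r z).intervalIntegrable _ _),
    integral_azimuthal_theta_deriv_eq_zero hV r z, sub_zero] at hF
  exact hF


/-- Joint continuity of `q ↦ f (meridionalPoint q.2 q.1 z)` on `ℝ × ℝ` for continuous `f`. [folklore] -/
private theorem continuous_comp_merid₂ {X : Type*} [TopologicalSpace X] {f : EuclideanSpace ℝ (Fin 3) → X}
    (hf : Continuous f) (z : ℝ) : Continuous fun q : ℝ × ℝ => f (meridionalPoint q.2 q.1 z) :=
  hf.comp (continuous_merid₃.comp (continuous_fst.prodMk (continuous_snd.prodMk continuous_const)))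

/-- Continuity of `θ ↦ f (meridionalPoint θ r z)`. [folklore] -/
private theorem continuous_comp_merid_theta {X : Type*} [TopologicalSpace X] {f : EuclideanSpace ℝ (Fin 3) → X}
    (hf : Continuous f) (r z : ℝ) : Continuous fun θ : ℝ => f (meridionalPoint θ r z) :=
  (continuous_comp_merid₂ hf z).comp (continuous_const.prodMk continuous_id)

/-- **Polar divergence theorem on the disc, integrated form**:
`∫₀^a ∫₀^{2π} div_h V (meridionalPoint θ ρ z) ρ dθ dρ = ∫₀^{2π} ⟪V(meridionalPoint θ a z), e_r⟫ a dθ` for a `C¹` field `V`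
(the circle of radius `0` carries no flux). [cite: LeiRenTian2025, §4 (4.3)–(4.4) (arXiv:2501.08976, p. 11)] -/
theorem discIntegral_divH_eq_radialFlux (hV : ContDiff ℝ 1 V) (a z : ℝ) :
    ∫ ρ in (0 : ℝ)..a, ∫ θ in (0 : ℝ)..(2 * Real.pi),
        (fderiv ℝ V (meridionalPoint θ ρ z) (EuclideanSpace.single 0 1) 0
          + fderiv ℝ V (meridionalPoint θ ρ z) (EuclideanSpace.single 1 1) 1) * ρ
      = ∫ θ in (0 : ℝ)..(2 * Real.pi), ⟪V (meridionalPoint θ a z), meridionalPoint θ 1 0⟫_ℝ * a := by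
  have hD : Continuous (fderiv ℝ V) := hV.continuous_fderiv one_ne_zero
  have hdivc : Continuous fun x => fderiv ℝ V x (EuclideanSpace.single 0 1) 0
      + fderiv ℝ V x (EuclideanSpace.single 1 1) 1 :=
    ((EuclideanSpace.proj (0 : Fin 3) : EuclideanSpace ℝ (Fin 3) →L[ℝ] ℝ).continuous.comp
      (hD.clm_apply continuous_const)).add
      ((EuclideanSpace.proj (1 : Fin 3) : EuclideanSpace ℝ (Fin 3) →L[ℝ] ℝ).continuous.comp
      (hD.clm_apply continuous_const))
  have hcont : Continuous fun ρ => ∫ θ in (0 : ℝ)..(2 * Real.pi),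
      (fderiv ℝ V (meridionalPoint θ ρ z) (EuclideanSpace.single 0 1) 0
        + fderiv ℝ V (meridionalPoint θ ρ z) (EuclideanSpace.single 1 1) 1) * ρ := by
    refine intervalIntegral.continuous_parametric_intervalIntegral_of_continuous' ?_ _ _
    exact ((continuous_comp_merid₂ hdivc z)).mul continuous_fst
  rw [integral_eq_sub_of_hasDerivAt (fun ρ _ => hasDerivAt_radialFlux hV ρ z)
    (hcont.intervalIntegrable _ _)]
  simp

/-! ### The flipped field `V = h(ω₃) ω` and its horizontal divergence

For a `C²` field `w` with `ω = curl w` and scalar functions `g, h, k : ℝ → ℝ` with `g' = h`, `h' = k`, the field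
`V = h(ω₃) ω` is `C¹` and `div_h V = k(ω₃) (∂₀ω₃ ω₀ + ∂₁ω₃ ω₁) + h(ω₃)(∂₀ω₀ + ∂₁ω₁)`, where
`∂₀ω₀ + ∂₁ω₁ = −∂₂ω₂` (`div ω = 0`) and `h(ω₃) ∂₂ω₂ = ∂₂ g(ω₃)`. -/

section Flipped

variable {w : EuclideanSpace ℝ (Fin 3) → EuclideanSpace ℝ (Fin 3)} {g h k : ℝ → ℝ}

/-- `curl w` is `C¹` for `C²` `w`. [folklore] -/
private theorem contDiff_one_curl (hw : ContDiff ℝ 2 w) : ContDiff ℝ 1 (curl w) :=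
  contDiff_curl (n := 1) (hw.of_le (by norm_num))

/-- The third component `x ↦ ω(x)₂` has derivative `v ↦ (Dω(x) v)₂`. [folklore] -/
private theorem hasFDerivAt_apply_two (hw : ContDiff ℝ 2 w) (x : EuclideanSpace ℝ (Fin 3)) :
    HasFDerivAt (fun y => curl w y 2)
      ((EuclideanSpace.proj (2 : Fin 3) : EuclideanSpace ℝ (Fin 3) →L[ℝ] ℝ).comp
        (fderiv ℝ (curl w) x)) x := by
  have hω : HasFDerivAt (curl w) (fderiv ℝ (curl w) x) x :=
    (((contDiff_one_curl hw).differentiable one_ne_zero) x).hasFDerivAt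
  have h := ((EuclideanSpace.proj (2 : Fin 3) : EuclideanSpace ℝ (Fin 3) →L[ℝ] ℝ).hasFDerivAt).comp x hω
  rw [EuclideanSpace.coe_proj] at h
  exact h

/-- Derivative of the flipped field: `D[h(ω₃) ω](x) v = h(ω₃(x)) Dω(x) v + (k(ω₃(x)) (Dω(x) v)₂) ω(x)`. [folklore] -/
private theorem hasFDerivAt_flipped (hw : ContDiff ℝ 2 w) (hhk : ∀ s, HasDerivAt h (k s) s)
    (x : EuclideanSpace ℝ (Fin 3)) :
    HasFDerivAt (fun y => h (curl w y 2) • curl w y)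
      (h (curl w x 2) • fderiv ℝ (curl w) x +
        (k (curl w x 2) • ((EuclideanSpace.proj (2 : Fin 3) : EuclideanSpace ℝ (Fin 3) →L[ℝ] ℝ).comp
          (fderiv ℝ (curl w) x))).smulRight (curl w x)) x := by
  have hω : HasFDerivAt (curl w) (fderiv ℝ (curl w) x) x :=
    (((contDiff_one_curl hw).differentiable one_ne_zero) x).hasFDerivAt
  have hc : HasFDerivAt (fun y => h (curl w y 2))
      (k (curl w x 2) • ((EuclideanSpace.proj (2 : Fin 3) : EuclideanSpace ℝ (Fin 3) →L[ℝ] ℝ).comp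
        (fderiv ℝ (curl w) x))) x :=
    (hhk (curl w x 2)).comp_hasFDerivAt x (hasFDerivAt_apply_two hw x)
  exact hc.smul hω

/-- Components of the derivative of the flipped field:
`(D[h(ω₃) ω](x) v)ᵢ = h(ω₃(x)) (Dω(x) v)ᵢ + k(ω₃(x)) (Dω(x) v)₂ ω(x)ᵢ`. [folklore] -/
private theorem fderiv_flipped_apply (hw : ContDiff ℝ 2 w) (hhk : ∀ s, HasDerivAt h (k s) s)
    (x v : EuclideanSpace ℝ (Fin 3)) (i : Fin 3) :
    fderiv ℝ (fun y => h (curl w y 2) • curl w y) x v i =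
      h (curl w x 2) * fderiv ℝ (curl w) x v i + k (curl w x 2) * fderiv ℝ (curl w) x v 2 * curl w x i := by
  rw [(hasFDerivAt_flipped hw hhk x).fderiv]
  simp only [FunLike.coe_add, FunLike.coe_smul, Pi.add_apply,
    Pi.smul_apply, ContinuousLinearMap.smulRight_apply, ContinuousLinearMap.comp_apply, PiLp.add_apply,
    PiLp.smul_apply, smul_eq_mul, PiLp.proj_apply, mul_comm]

/-- The flipped field is `C¹` when `h` is `C¹`. [folklore] -/
private theorem contDiff_flipped (hw : ContDiff ℝ 2 w) (hh : ContDiff ℝ 1 h) :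
    ContDiff ℝ 1 (fun y => h (curl w y 2) • curl w y) := by
  have hω := contDiff_one_curl hw
  have h3 : ContDiff ℝ 1 (fun y => curl w y 2) :=
    (EuclideanSpace.proj (2 : Fin 3) : EuclideanSpace ℝ (Fin 3) →L[ℝ] ℝ).contDiff.comp hω
  exact (hh.comp h3).smul hω

/-- `div ω = 0` in coordinates: `(Dω e₀)₀ + (Dω e₁)₁ = −(Dω e₂)₂` for `ω = curl w`, `w ∈ C²`. [folklore] -/
private theorem trace_fderiv_curl (hw : ContDiff ℝ 2 w) (x : EuclideanSpace ℝ (Fin 3)) :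
    fderiv ℝ (curl w) x (EuclideanSpace.single 0 1) 0 + fderiv ℝ (curl w) x (EuclideanSpace.single 1 1) 1 =
      -(fderiv ℝ (curl w) x (EuclideanSpace.single 2 1) 2) := by
  have h0 := divergence_curl_eq_zero_holds w hw x
  rw [divergence_eq_sum_inner_fderiv (EuclideanSpace.basisFun (Fin 3) ℝ)] at h0
  simp only [EuclideanSpace.basisFun_apply, Fin.sum_univ_three, EuclideanSpace.inner_single_left,
    map_one, one_mul] at h0
  linarith [h0]

/-- **The horizontal divergence of the flipped field**: with `E(x) = k(ω₃) ((Dω e₀)₂ ω₀ + (Dω e₁)₂ ω₁)`,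
`div_h [h(ω₃) ω](x) = E(x) − D[g ∘ ω₃](x) e₃` (`g' = h`, `h' = k`, `div ω = 0`). [cite: LeiRenTian2025, §3 (3.2) (arXiv:2501.08976, p. 8: `∇·ω̃ = 1_{ω₃≠0} sgn(ω₃) ∇·ω = 0`, regularised form)] -/
theorem divH_flipped_eq (hw : ContDiff ℝ 2 w) (hgh : ∀ s, HasDerivAt g (h s) s)
    (hhk : ∀ s, HasDerivAt h (k s) s) (x : EuclideanSpace ℝ (Fin 3)) :
    fderiv ℝ (fun y => h (curl w y 2) • curl w y) x (EuclideanSpace.single 0 1) 0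
      + fderiv ℝ (fun y => h (curl w y 2) • curl w y) x (EuclideanSpace.single 1 1) 1 =
      k (curl w x 2) * (fderiv ℝ (curl w) x (EuclideanSpace.single 0 1) 2 * curl w x 0
        + fderiv ℝ (curl w) x (EuclideanSpace.single 1 1) 2 * curl w x 1)
      - fderiv ℝ (fun y => g (curl w y 2)) x eZ := by
  have hD3 : fderiv ℝ (fun y => g (curl w y 2)) x eZ =
      h (curl w x 2) * fderiv ℝ (curl w) x (EuclideanSpace.single 2 1) 2 := by
    have hc : HasFDerivAt (fun y => g (curl w y 2)) _ x :=
      (hgh (curl w x 2)).comp_hasFDerivAt x (hasFDerivAt_apply_two hw x)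
    rw [hc.fderiv]
    simp [eZ, smul_eq_mul]
  rw [fderiv_flipped_apply hw hhk, fderiv_flipped_apply hw hhk, hD3]
  have ht := trace_fderiv_curl hw x
  linear_combination (h (curl w x 2)) * ht

/-- **FTC along vertical lines**: `g(ω₃(meridionalPoint θ ρ z₂)) − g(ω₃(meridionalPoint θ ρ z₁)) = ∫_{z₁}^{z₂} D[g∘ω₃](meridionalPoint θ ρ ζ) e₃ dζ`. [folklore] -/
private theorem vertical_ftc (hw : ContDiff ℝ 2 w) (hgh : ∀ s, HasDerivAt g (h s) s) (hh : Continuous h)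
    (ρ θ z₁ z₂ : ℝ) :
    ∫ ζ in z₁..z₂, fderiv ℝ (fun y => g (curl w y 2)) (meridionalPoint θ ρ ζ) eZ =
      g (curl w (meridionalPoint θ ρ z₂) 2) - g (curl w (meridionalPoint θ ρ z₁) 2) := by
  have hω := contDiff_one_curl hw
  -- the composite `ζ ↦ g(ω₃(meridionalPoint θ ρ ζ))` and its derivative
  have hderiv : ∀ ζ : ℝ, HasDerivAt (fun ζ' => g (curl w (meridionalPoint θ ρ ζ') 2))
      (fderiv ℝ (fun y => g (curl w y 2)) (meridionalPoint θ ρ ζ) eZ) ζ := by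
    intro ζ
    have hG : HasFDerivAt (fun y => g (curl w y 2))
        (fderiv ℝ (fun y => g (curl w y 2)) (meridionalPoint θ ρ ζ)) (meridionalPoint θ ρ ζ) :=
      ((hgh _).comp_hasFDerivAt _ (hasFDerivAt_apply_two hw _)).differentiableAt.hasFDerivAt
    exact hG.comp_hasDerivAt ζ (hasDerivAt_merid_z ρ θ ζ)
  -- continuity of the derivative along the line
  have hcont : Continuous fun ζ => fderiv ℝ (fun y => g (curl w y 2)) (meridionalPoint θ ρ ζ) eZ := by
    have hform : (fun ζ => fderiv ℝ (fun y => g (curl w y 2)) (meridionalPoint θ ρ ζ) eZ) =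
        fun ζ => h (curl w (meridionalPoint θ ρ ζ) 2) * fderiv ℝ (curl w) (meridionalPoint θ ρ ζ) eZ 2 := by
      funext ζ
      have hc : HasFDerivAt (fun y => g (curl w y 2)) _ (meridionalPoint θ ρ ζ) :=
        (hgh _).comp_hasFDerivAt _ (hasFDerivAt_apply_two hw (meridionalPoint θ ρ ζ))
      rw [hc.fderiv]
      simp [smul_eq_mul]
    rw [hform]
    have hp : Continuous fun ζ => meridionalPoint θ ρ ζ :=
      continuous_merid₃.comp (continuous_const.prodMk (continuous_const.prodMk continuous_id))
    have h1 : Continuous fun ζ => h (curl w (meridionalPoint θ ρ ζ) 2) :=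
      hh.comp ((EuclideanSpace.proj (2 : Fin 3) : EuclideanSpace ℝ (Fin 3) →L[ℝ] ℝ).continuous.comp
        (hω.continuous.comp hp))
    have h2 : Continuous fun ζ => fderiv ℝ (curl w) (meridionalPoint θ ρ ζ) eZ 2 :=
      (EuclideanSpace.proj (2 : Fin 3) : EuclideanSpace ℝ (Fin 3) →L[ℝ] ℝ).continuous.comp
        (((hω.continuous_fderiv one_ne_zero).comp hp).clm_apply continuous_const)
    exact h1.mul h2
  exact integral_eq_sub_of_hasDerivAt (fun ζ _ => hderiv ζ) (hcont.intervalIntegrable _ _)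

end Flipped


/-! ### The regularisation `g_ε(s) = √(s² + ε²)`, `h_ε = g_ε' = s/√(s²+ε²)`, `k_ε = h_ε' = ε²/((s²+ε²)√(s²+ε²))` -/

section Regularisation

variable {ε : ℝ}

/-- `s² + ε² > 0` for `ε ≠ 0`. [folklore] -/
private theorem sq_add_sq_pos (hε : ε ≠ 0) (s : ℝ) : 0 < s ^ 2 + ε ^ 2 := by positivity

/-- `√(s² + ε²) > 0` for `ε ≠ 0`. [folklore] -/
private theorem sqrt_sq_add_sq_pos (hε : ε ≠ 0) (s : ℝ) : 0 < Real.sqrt (s ^ 2 + ε ^ 2) :=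
  Real.sqrt_pos.2 (sq_add_sq_pos hε s)

/-- `|s| ≤ √(s² + ε²)`. [folklore] -/
private theorem abs_le_sqrt_sq_add_sq (s ε : ℝ) : |s| ≤ Real.sqrt (s ^ 2 + ε ^ 2) := by
  rw [← Real.sqrt_sq_eq_abs]
  exact Real.sqrt_le_sqrt (by nlinarith [sq_nonneg ε])

/-- `g_ε' = h_ε`. [folklore] -/
private theorem hasDerivAt_gReg (hε : ε ≠ 0) (s : ℝ) :
    HasDerivAt (fun s => Real.sqrt (s ^ 2 + ε ^ 2)) (s / Real.sqrt (s ^ 2 + ε ^ 2)) s := by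
  have h1 : HasDerivAt (fun s => s ^ 2 + ε ^ 2) (2 * s) s := by
    simpa using (hasDerivAt_pow 2 s).add_const (ε ^ 2)
  refine (h1.sqrt (sq_add_sq_pos hε s).ne').congr_deriv ?_
  have hr := sqrt_sq_add_sq_pos hε s
  field_simp

/-- `h_ε' = k_ε`. [folklore] -/
private theorem hasDerivAt_hReg (hε : ε ≠ 0) (s : ℝ) :
    HasDerivAt (fun s => s / Real.sqrt (s ^ 2 + ε ^ 2))
      (ε ^ 2 / ((s ^ 2 + ε ^ 2) * Real.sqrt (s ^ 2 + ε ^ 2))) s := by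
  have hq := sq_add_sq_pos hε s
  have hr := sqrt_sq_add_sq_pos hε s
  refine ((hasDerivAt_id s).div (hasDerivAt_gReg hε s) hr.ne').congr_deriv ?_
  have key : Real.sqrt (s ^ 2 + ε ^ 2) ^ 2 = s ^ 2 + ε ^ 2 := Real.sq_sqrt hq.le
  simp only [id_eq, one_mul]
  field_simp
  rw [key]
  ring

/-- `g_ε` is smooth. [folklore] -/
private theorem contDiff_gReg (hε : ε ≠ 0) {n : WithTop ℕ∞} :
    ContDiff ℝ n (fun s : ℝ => Real.sqrt (s ^ 2 + ε ^ 2)) :=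
  (contDiff_id.pow 2 |>.add contDiff_const).sqrt fun s => (sq_add_sq_pos hε s).ne'

/-- `h_ε` is smooth. [folklore] -/
private theorem contDiff_hReg (hε : ε ≠ 0) {n : WithTop ℕ∞} :
    ContDiff ℝ n (fun s : ℝ => s / Real.sqrt (s ^ 2 + ε ^ 2)) :=
  contDiff_id.div (contDiff_gReg hε) fun s => (sqrt_sq_add_sq_pos hε s).ne'

/-- `k_ε` is continuous. [folklore] -/
private theorem continuous_kReg (hε : ε ≠ 0) :
    Continuous (fun s : ℝ => ε ^ 2 / ((s ^ 2 + ε ^ 2) * Real.sqrt (s ^ 2 + ε ^ 2))) := by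
  refine continuous_const.div (by fun_prop) fun s => ?_
  exact (mul_pos (sq_add_sq_pos hε s) (sqrt_sq_add_sq_pos hε s)).ne'

/-- `|h_ε| ≤ 1`. [folklore] -/
private theorem abs_hReg_le_one (hε : ε ≠ 0) (s : ℝ) : |s / Real.sqrt (s ^ 2 + ε ^ 2)| ≤ 1 := by
  rw [abs_div, abs_of_pos (sqrt_sq_add_sq_pos hε s), div_le_one (sqrt_sq_add_sq_pos hε s)]
  exact abs_le_sqrt_sq_add_sq s ε

/-- `|k_ε(s) s| ≤ 1`. [folklore] -/
private theorem abs_kReg_mul_le_one (hε : ε ≠ 0) (s : ℝ) :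
    |ε ^ 2 / ((s ^ 2 + ε ^ 2) * Real.sqrt (s ^ 2 + ε ^ 2)) * s| ≤ 1 := by
  have hq := sq_add_sq_pos hε s
  have hr := sqrt_sq_add_sq_pos hε s
  rw [div_mul_eq_mul_div, abs_div, abs_of_pos (mul_pos hq hr), div_le_one (mul_pos hq hr), abs_mul,
    abs_of_nonneg (sq_nonneg ε)]
  have h1 : ε ^ 2 ≤ s ^ 2 + ε ^ 2 := by nlinarith [sq_nonneg s]
  exact mul_le_mul h1 (abs_le_sqrt_sq_add_sq s ε) (abs_nonneg s) hq.le

/-- `| g_ε(s) − |s| | ≤ ε` for `ε > 0`. [folklore] -/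
private theorem abs_gReg_sub_abs_le (hε : 0 < ε) (s : ℝ) : |(Real.sqrt (s ^ 2 + ε ^ 2) - |s|)| ≤ ε := by
  have h1 : |s| ≤ Real.sqrt (s ^ 2 + ε ^ 2) := abs_le_sqrt_sq_add_sq s ε
  have h2 : Real.sqrt (s ^ 2 + ε ^ 2) ≤ |s| + ε := by
    rw [Real.sqrt_le_left (by positivity)]
    nlinarith [abs_nonneg s, sq_abs s]
  rw [abs_le]
  constructor <;> linarith

/-- `k_ε(s) s → 0` as `ε → 0⁺`, for every fixed `s`. [folklore] -/
private theorem tendsto_kReg_mul (s : ℝ) :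
    Tendsto (fun ε : ℝ => ε ^ 2 / ((s ^ 2 + ε ^ 2) * Real.sqrt (s ^ 2 + ε ^ 2)) * s)
      (𝓝[>] 0) (𝓝 0) := by
  rcases eq_or_ne s 0 with rfl | hs
  · simp only [mul_zero]
    exact tendsto_const_nhds
  · have hden : (s ^ 2 + (0 : ℝ) ^ 2) * Real.sqrt (s ^ 2 + (0 : ℝ) ^ 2) ≠ 0 := by
      have h1 : 0 < s ^ 2 := by positivity
      have h2 : 0 < Real.sqrt (s ^ 2) := Real.sqrt_pos.2 h1
      simp only [ne_eq, zero_pow two_ne_zero, add_zero]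
      exact (mul_pos h1 h2).ne'
    have hc : Continuous fun ε : ℝ => (s ^ 2 + ε ^ 2) * Real.sqrt (s ^ 2 + ε ^ 2) :=
      (continuous_const.add (continuous_id.pow 2)).mul
        (Real.continuous_sqrt.comp (continuous_const.add (continuous_id.pow 2)))
    have hcont : ContinuousAt
        (fun ε : ℝ => ε ^ 2 / ((s ^ 2 + ε ^ 2) * Real.sqrt (s ^ 2 + ε ^ 2)) * s) 0 :=
      (((continuous_id.pow 2).continuousAt).div hc.continuousAt hden).mul continuousAt_const
    have h0 : (0 : ℝ) ^ 2 / ((s ^ 2 + (0 : ℝ) ^ 2) * Real.sqrt (s ^ 2 + (0 : ℝ) ^ 2)) * s = 0 := by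
      simp
    have := hcont.tendsto
    rw [h0] at this
    exact this.mono_left nhdsWithin_le_nhds

end Regularisation

/-! ### The error density `E = k(ω₃) ((Dω e₀)₂ ω₀ + (Dω e₁)₂ ω₁)` under the cone -/

section ErrorDensity

variable {w : EuclideanSpace ℝ (Fin 3) → EuclideanSpace ℝ (Fin 3)} {k : ℝ → ℝ}

/-- Under the slack-free cone `‖ω(x)‖ ≤ C |ω₃(x)|`:
`|k(ω₃)((Dω e₀)₂ ω₀ + (Dω e₁)₂ ω₁)| ≤ 2 C ‖Dω(x)‖ |k(ω₃) ω₃|`. [folklore] -/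
private theorem abs_errorDensity_le {C : ℝ} {x : EuclideanSpace ℝ (Fin 3)}
    (hcone : ‖curl w x‖ ≤ C * |curl w x 2|) :
    |k (curl w x 2) * (fderiv ℝ (curl w) x (EuclideanSpace.single 0 1) 2 * curl w x 0
        + fderiv ℝ (curl w) x (EuclideanSpace.single 1 1) 2 * curl w x 1)|
      ≤ 2 * C * ‖fderiv ℝ (curl w) x‖ * |k (curl w x 2) * curl w x 2| := by
  set L := fderiv ℝ (curl w) x with hL
  have hcoord : ∀ (v : EuclideanSpace ℝ (Fin 3)) (i : Fin 3), |v i| ≤ ‖v‖ := fun v i => by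
    simpa using PiLp.norm_apply_le v i
  have hLe : ∀ i : Fin 3, |L (EuclideanSpace.single i 1) 2| ≤ ‖L‖ := fun i => by
    calc |L (EuclideanSpace.single i 1) 2| ≤ ‖L (EuclideanSpace.single i 1)‖ := hcoord _ _
      _ ≤ ‖L‖ * ‖EuclideanSpace.single i (1 : ℝ)‖ := L.le_opNorm _
      _ = ‖L‖ := by simp
  have hω0 : |curl w x 0| ≤ C * |curl w x 2| := (hcoord _ _).trans hcone
  have hω1 : |curl w x 1| ≤ C * |curl w x 2| := (hcoord _ _).trans hcone
  have hC : 0 ≤ C * |curl w x 2| := (norm_nonneg _).trans hcone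
  have hsum : |L (EuclideanSpace.single 0 1) 2 * curl w x 0 + L (EuclideanSpace.single 1 1) 2 * curl w x 1|
      ≤ 2 * ‖L‖ * (C * |curl w x 2|) := by
    calc |L (EuclideanSpace.single 0 1) 2 * curl w x 0 + L (EuclideanSpace.single 1 1) 2 * curl w x 1|
        ≤ |L (EuclideanSpace.single 0 1) 2 * curl w x 0| + |L (EuclideanSpace.single 1 1) 2 * curl w x 1| :=
          abs_add_le _ _
      _ = |L (EuclideanSpace.single 0 1) 2| * |curl w x 0| + |L (EuclideanSpace.single 1 1) 2| * |curl w x 1| := by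
          rw [abs_mul, abs_mul]
      _ ≤ ‖L‖ * (C * |curl w x 2|) + ‖L‖ * (C * |curl w x 2|) :=
          add_le_add (mul_le_mul (hLe 0) hω0 (abs_nonneg _) (norm_nonneg _))
            (mul_le_mul (hLe 1) hω1 (abs_nonneg _) (norm_nonneg _))
      _ = 2 * ‖L‖ * (C * |curl w x 2|) := by ring
  rw [abs_mul]
  calc |k (curl w x 2)| * |L (EuclideanSpace.single 0 1) 2 * curl w x 0 + L (EuclideanSpace.single 1 1) 2 * curl w x 1|
      ≤ |k (curl w x 2)| * (2 * ‖L‖ * (C * |curl w x 2|)) :=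
        mul_le_mul_of_nonneg_left hsum (abs_nonneg _)
    _ = 2 * C * ‖L‖ * |k (curl w x 2) * curl w x 2| := by rw [abs_mul]; ring

end ErrorDensity


/-! ### Fubini on boxes for continuous integrands -/

section Fubini

/-- A continuous function on `ℝ²` is integrable on every product of bounded intervals. [folklore] -/
private theorem integrableOn_uIoc_prod_of_continuous {F : ℝ × ℝ → ℝ} (hF : Continuous F) (a b c d : ℝ) :
    IntegrableOn F (uIoc a b ×ˢ uIoc c d) :=
  (hF.continuousOn.integrableOn_compact (isCompact_uIcc.prod isCompact_uIcc)).mono_set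
    (Set.prod_mono uIoc_subset_uIcc uIoc_subset_uIcc)

/-- Moving the innermost of three interval integrals of a continuous function to the outside:
`∫ρ ∫θ ∫ζ F = ∫ζ ∫ρ ∫θ F`. [folklore] -/
private theorem integral₃_rotate {F : ℝ → ℝ → ℝ → ℝ}
    (hF : Continuous fun q : ℝ × ℝ × ℝ => F q.1 q.2.1 q.2.2) (a₁ a₂ b₁ b₂ c₁ c₂ : ℝ) :
    ∫ ρ in a₁..a₂, ∫ θ in b₁..b₂, ∫ ζ in c₁..c₂, F ρ θ ζ =
      ∫ ζ in c₁..c₂, ∫ ρ in a₁..a₂, ∫ θ in b₁..b₂, F ρ θ ζ := by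
  have h1 : ∀ ρ, ∫ θ in b₁..b₂, ∫ ζ in c₁..c₂, F ρ θ ζ = ∫ ζ in c₁..c₂, ∫ θ in b₁..b₂, F ρ θ ζ := by
    intro ρ
    refine MeasureTheory.intervalIntegral_intervalIntegral_swap
      (integrableOn_uIoc_prod_of_continuous ?_ _ _ _ _)
    exact hF.comp (continuous_const.prodMk (continuous_fst.prodMk continuous_snd))
  have hG : Continuous (Function.uncurry fun ρ ζ => ∫ θ in b₁..b₂, F ρ θ ζ) := by
    have hf : Continuous (Function.uncurry fun (p : ℝ × ℝ) (θ : ℝ) => F p.1 θ p.2) :=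
      hF.comp (continuous_fst.fst.prodMk (continuous_snd.prodMk continuous_fst.snd))
    exact intervalIntegral.continuous_parametric_intervalIntegral_of_continuous' hf b₁ b₂
  rw [intervalIntegral.integral_congr (fun ρ _ => h1 ρ)]
  exact MeasureTheory.intervalIntegral_intervalIntegral_swap
    (integrableOn_uIoc_prod_of_continuous hG _ _ _ _)

end Fubini

/-! ### The regularised flux identity -/

section Identity

variable {w : EuclideanSpace ℝ (Fin 3) → EuclideanSpace ℝ (Fin 3)} {g h k : ℝ → ℝ}

/-- Coordinates of continuous `ℝ³`-valued maps are continuous. [folklore] -/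
private theorem continuous_coord {X : Type*} [TopologicalSpace X] {f : X → EuclideanSpace ℝ (Fin 3)}
    (hf : Continuous f) (i : Fin 3) : Continuous fun x => f x i :=
  (EuclideanSpace.proj i : EuclideanSpace ℝ (Fin 3) →L[ℝ] ℝ).continuous.comp hf

/-- The vertical derivative of `g ∘ ω₃` in closed form: `D[g∘ω₃](x) e₃ = h(ω₃(x)) (Dω(x) e₃)₂`. [folklore] -/
private theorem fderiv_g_comp_e3 (hw : ContDiff ℝ 2 w) (hgh : ∀ s, HasDerivAt g (h s) s)
    (x : EuclideanSpace ℝ (Fin 3)) :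
    fderiv ℝ (fun y => g (curl w y 2)) x eZ = h (curl w x 2) * fderiv ℝ (curl w) x eZ 2 := by
  have hc : HasFDerivAt (fun y => g (curl w y 2)) _ x :=
    (hgh _).comp_hasFDerivAt _ (hasFDerivAt_apply_two hw x)
  rw [hc.fderiv]
  simp [smul_eq_mul]

/-- Continuity of the error density `E = k(ω₃)((Dω e₀)₂ ω₀ + (Dω e₁)₂ ω₁)`. [folklore] -/
private theorem continuous_errorDensity (hw : ContDiff ℝ 2 w) (hk : Continuous k) :
    Continuous fun x => k (curl w x 2) *
      (fderiv ℝ (curl w) x (EuclideanSpace.single 0 1) 2 * curl w x 0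
        + fderiv ℝ (curl w) x (EuclideanSpace.single 1 1) 2 * curl w x 1) := by
  have hω := contDiff_one_curl hw
  have hωc : Continuous (curl w) := hω.continuous
  have hD : Continuous (fderiv ℝ (curl w)) := hω.continuous_fderiv one_ne_zero
  refine (hk.comp (continuous_coord hωc 2)).mul ?_
  exact ((continuous_coord (hD.clm_apply continuous_const) 2).mul (continuous_coord hωc 0)).add
    ((continuous_coord (hD.clm_apply continuous_const) 2).mul (continuous_coord hωc 1))

/-- Continuity of the vertical derivative `x ↦ D[g∘ω₃](x) e₃`. [folklore] -/
private theorem continuous_fderiv_g_comp_e3 (hw : ContDiff ℝ 2 w) (hgh : ∀ s, HasDerivAt g (h s) s)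
    (hh : Continuous h) : Continuous fun x => fderiv ℝ (fun y => g (curl w y 2)) x eZ := by
  have hω := contDiff_one_curl hw
  have hform : (fun x => fderiv ℝ (fun y => g (curl w y 2)) x eZ) =
      fun x => h (curl w x 2) * fderiv ℝ (curl w) x eZ 2 := funext (fderiv_g_comp_e3 hw hgh)
  rw [hform]
  exact (hh.comp (continuous_coord hω.continuous 2)).mul
    (continuous_coord ((hω.continuous_fderiv one_ne_zero).clm_apply continuous_const) 2)

/-- **The regularised flux identity.** For `w ∈ C²`, `g' = h ∈ C¹`, `h' = k` continuous:
`G(z₂) − G(z₁) = ∫_{z₁}^{z₂} ( ∫₀^a∫₀^{2π} E ρ − ∫₀^{2π} h(ω₃)⟪ω, e_r⟫ a ) dζ` where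
`G(z) = ∫₀^a ∫₀^{2π} g(ω₃(meridionalPoint θ ρ z)) ρ dθ dρ` and `E = k(ω₃)((Dω e₀)₂ ω₀ + (Dω e₁)₂ ω₁)`. [cite: LeiRenTian2025, §3 (3.2)–(3.3) (arXiv:2501.08976, p. 8), regularised form] -/
theorem regularisedFlux_sub_eq (hw : ContDiff ℝ 2 w) (hgh : ∀ s, HasDerivAt g (h s) s)
    (hhk : ∀ s, HasDerivAt h (k s) s) (hh : ContDiff ℝ 1 h) (hk : Continuous k) (a z₁ z₂ : ℝ) :
    (∫ ρ in (0 : ℝ)..a, ∫ θ in (0 : ℝ)..(2 * Real.pi), g (curl w (meridionalPoint θ ρ z₂) 2) * ρ) -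
        (∫ ρ in (0 : ℝ)..a, ∫ θ in (0 : ℝ)..(2 * Real.pi), g (curl w (meridionalPoint θ ρ z₁) 2) * ρ) =
      ∫ ζ in z₁..z₂,
        ((∫ ρ in (0 : ℝ)..a, ∫ θ in (0 : ℝ)..(2 * Real.pi),
            k (curl w (meridionalPoint θ ρ ζ) 2) *
              (fderiv ℝ (curl w) (meridionalPoint θ ρ ζ) (EuclideanSpace.single 0 1) 2 * curl w (meridionalPoint θ ρ ζ) 0
                + fderiv ℝ (curl w) (meridionalPoint θ ρ ζ) (EuclideanSpace.single 1 1) 2 * curl w (meridionalPoint θ ρ ζ) 1) * ρ)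
          - ∫ θ in (0 : ℝ)..(2 * Real.pi),
              h (curl w (meridionalPoint θ a ζ) 2) * ⟪curl w (meridionalPoint θ a ζ), meridionalPoint θ 1 0⟫_ℝ * a) := by
  have hω := contDiff_one_curl hw
  have hωc : Continuous (curl w) := hω.continuous
  have hhc : Continuous h := hh.continuous
  have hgc : Continuous g := continuous_iff_continuousAt.2 fun s => (hgh s).continuousAt
  -- the three densities and their continuity
  have hDc := continuous_fderiv_g_comp_e3 hw hgh hhc
  have hEc := continuous_errorDensity hw hk (w := w)
  have hV : ContDiff ℝ 1 (fun y => h (curl w y 2) • curl w y) := contDiff_flipped hw hh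
  -- pointwise: `D = E − div_h V`
  have hpt : ∀ x, fderiv ℝ (fun y => g (curl w y 2)) x eZ =
      k (curl w x 2) * (fderiv ℝ (curl w) x (EuclideanSpace.single 0 1) 2 * curl w x 0
        + fderiv ℝ (curl w) x (EuclideanSpace.single 1 1) 2 * curl w x 1)
      - (fderiv ℝ (fun y => h (curl w y 2) • curl w y) x (EuclideanSpace.single 0 1) 0
        + fderiv ℝ (fun y => h (curl w y 2) • curl w y) x (EuclideanSpace.single 1 1) 1) := by
    intro x
    rw [divH_flipped_eq hw hgh hhk x]
    ring
  have hdivc : Continuous fun x =>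
      fderiv ℝ (fun y => h (curl w y 2) • curl w y) x (EuclideanSpace.single 0 1) 0
        + fderiv ℝ (fun y => h (curl w y 2) • curl w y) x (EuclideanSpace.single 1 1) 1 := by
    have : (fun x => fderiv ℝ (fun y => h (curl w y 2) • curl w y) x (EuclideanSpace.single 0 1) 0
        + fderiv ℝ (fun y => h (curl w y 2) • curl w y) x (EuclideanSpace.single 1 1) 1) =
        fun x => k (curl w x 2) * (fderiv ℝ (curl w) x (EuclideanSpace.single 0 1) 2 * curl w x 0
          + fderiv ℝ (curl w) x (EuclideanSpace.single 1 1) 2 * curl w x 1)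
          - fderiv ℝ (fun y => g (curl w y 2)) x eZ := by
      funext x; rw [hpt x]; ring
    rw [this]
    exact hEc.sub hDc
  -- Step 1: the difference of the two disc integrals is the disc integral of the difference
  have hinner : ∀ z : ℝ, Continuous fun q : ℝ × ℝ => g (curl w (meridionalPoint q.2 q.1 z) 2) * q.1 := fun z =>
    (hgc.comp (continuous_coord (continuous_comp_merid₂ hωc z) 2)).mul continuous_fst
  have hI : ∀ z ρ : ℝ, IntervalIntegrable (fun θ => g (curl w (meridionalPoint θ ρ z) 2) * ρ) volume 0 (2 * Real.pi) :=
    fun z ρ => ((hinner z).comp (continuous_const.prodMk continuous_id)).intervalIntegrable _ _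
  have hO : ∀ z : ℝ, IntervalIntegrable (fun ρ => ∫ θ in (0 : ℝ)..(2 * Real.pi),
      g (curl w (meridionalPoint θ ρ z) 2) * ρ) volume 0 a := fun z =>
    (intervalIntegral.continuous_parametric_intervalIntegral_of_continuous' (hinner z) _ _).intervalIntegrable _ _
  rw [← intervalIntegral.integral_sub (hO z₂) (hO z₁),
    intervalIntegral.integral_congr (fun ρ _ => (intervalIntegral.integral_sub (hI z₂ ρ) (hI z₁ ρ)).symm)]
  -- Step 2: FTC along vertical lines, and `ρ` inside the `ζ`-integral
  have hstep2 : ∀ ρ θ : ℝ, g (curl w (meridionalPoint θ ρ z₂) 2) * ρ - g (curl w (meridionalPoint θ ρ z₁) 2) * ρ =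
      ∫ ζ in z₁..z₂, fderiv ℝ (fun y => g (curl w y 2)) (meridionalPoint θ ρ ζ) eZ * ρ := by
    intro ρ θ
    rw [intervalIntegral.integral_mul_const, vertical_ftc hw hgh hhc ρ θ z₁ z₂]
    ring
  simp_rw [hstep2]
  -- Step 3: rotate the `ζ`-integral to the outside
  rw [integral₃_rotate (F := fun ρ θ ζ => fderiv ℝ (fun y => g (curl w y 2)) (meridionalPoint θ ρ ζ) eZ * ρ)
    ((hDc.comp continuous_merid₃).mul continuous_fst)]
  -- Step 4: for each `ζ`, split `D = E − div_h V` and apply the polar divergence theorem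
  refine intervalIntegral.integral_congr fun ζ _ => ?_
  have hEI : ∀ ρ : ℝ, IntervalIntegrable (fun θ => k (curl w (meridionalPoint θ ρ ζ) 2) *
      (fderiv ℝ (curl w) (meridionalPoint θ ρ ζ) (EuclideanSpace.single 0 1) 2 * curl w (meridionalPoint θ ρ ζ) 0
        + fderiv ℝ (curl w) (meridionalPoint θ ρ ζ) (EuclideanSpace.single 1 1) 2 * curl w (meridionalPoint θ ρ ζ) 1) * ρ)
      volume 0 (2 * Real.pi) := fun ρ =>
    ((continuous_comp_merid_theta hEc ρ ζ).mul continuous_const).intervalIntegrable _ _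
  have hdivI : ∀ ρ : ℝ, IntervalIntegrable (fun θ =>
      (fderiv ℝ (fun y => h (curl w y 2) • curl w y) (meridionalPoint θ ρ ζ) (EuclideanSpace.single 0 1) 0
        + fderiv ℝ (fun y => h (curl w y 2) • curl w y) (meridionalPoint θ ρ ζ) (EuclideanSpace.single 1 1) 1) * ρ)
      volume 0 (2 * Real.pi) := fun ρ =>
    ((continuous_comp_merid_theta hdivc ρ ζ).mul continuous_const).intervalIntegrable _ _
  have hEO : IntervalIntegrable (fun ρ => ∫ θ in (0 : ℝ)..(2 * Real.pi), k (curl w (meridionalPoint θ ρ ζ) 2) *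
      (fderiv ℝ (curl w) (meridionalPoint θ ρ ζ) (EuclideanSpace.single 0 1) 2 * curl w (meridionalPoint θ ρ ζ) 0
        + fderiv ℝ (curl w) (meridionalPoint θ ρ ζ) (EuclideanSpace.single 1 1) 2 * curl w (meridionalPoint θ ρ ζ) 1) * ρ)
      volume 0 a :=
    (intervalIntegral.continuous_parametric_intervalIntegral_of_continuous'
      ((continuous_comp_merid₂ hEc ζ).mul continuous_fst) _ _).intervalIntegrable _ _
  have hdivO : IntervalIntegrable (fun ρ => ∫ θ in (0 : ℝ)..(2 * Real.pi),
      (fderiv ℝ (fun y => h (curl w y 2) • curl w y) (meridionalPoint θ ρ ζ) (EuclideanSpace.single 0 1) 0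
        + fderiv ℝ (fun y => h (curl w y 2) • curl w y) (meridionalPoint θ ρ ζ) (EuclideanSpace.single 1 1) 1) * ρ)
      volume 0 a :=
    (intervalIntegral.continuous_parametric_intervalIntegral_of_continuous'
      ((continuous_comp_merid₂ hdivc ζ).mul continuous_fst) _ _).intervalIntegrable _ _
  have hsplit : ∀ ρ : ℝ, ∫ θ in (0 : ℝ)..(2 * Real.pi),
      fderiv ℝ (fun y => g (curl w y 2)) (meridionalPoint θ ρ ζ) eZ * ρ =
      (∫ θ in (0 : ℝ)..(2 * Real.pi), k (curl w (meridionalPoint θ ρ ζ) 2) *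
        (fderiv ℝ (curl w) (meridionalPoint θ ρ ζ) (EuclideanSpace.single 0 1) 2 * curl w (meridionalPoint θ ρ ζ) 0
          + fderiv ℝ (curl w) (meridionalPoint θ ρ ζ) (EuclideanSpace.single 1 1) 2 * curl w (meridionalPoint θ ρ ζ) 1) * ρ)
      - ∫ θ in (0 : ℝ)..(2 * Real.pi),
        (fderiv ℝ (fun y => h (curl w y 2) • curl w y) (meridionalPoint θ ρ ζ) (EuclideanSpace.single 0 1) 0
          + fderiv ℝ (fun y => h (curl w y 2) • curl w y) (meridionalPoint θ ρ ζ) (EuclideanSpace.single 1 1) 1) * ρ := by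
    intro ρ
    rw [← intervalIntegral.integral_sub (hEI ρ) (hdivI ρ)]
    refine intervalIntegral.integral_congr fun θ _ => ?_
    rw [hpt]
    ring
  rw [intervalIntegral.integral_congr (fun ρ _ => hsplit ρ), intervalIntegral.integral_sub hEO hdivO,
    discIntegral_divH_eq_radialFlux hV a ζ]
  congr 1
  refine intervalIntegral.integral_congr fun θ _ => ?_
  simp only [real_inner_smul_left]

end Identity


/-! ### The main estimate: `|Γ(a, z₂) − Γ(a, z₁)| ≤ ∫∫_{lateral} |ω|` -/

section Main

variable {w : EuclideanSpace ℝ (Fin 3) → EuclideanSpace ℝ (Fin 3)}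

/-- Uniform bound of the regularised error density under the cone: `|E_ε(x)| ≤ 2 C M` whenever
`‖Dω(x)‖ ≤ M`, `C ≥ 0`. [folklore] -/
private theorem abs_errorDensity_reg_le {C M ε : ℝ} (hC : 0 ≤ C) (hε : ε ≠ 0) {x : EuclideanSpace ℝ (Fin 3)}
    (hcone : ‖curl w x‖ ≤ C * |curl w x 2|) (hM : ‖fderiv ℝ (curl w) x‖ ≤ M) :
    |ε ^ 2 / ((curl w x 2 ^ 2 + ε ^ 2) * Real.sqrt (curl w x 2 ^ 2 + ε ^ 2)) *
        (fderiv ℝ (curl w) x (EuclideanSpace.single 0 1) 2 * curl w x 0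
          + fderiv ℝ (curl w) x (EuclideanSpace.single 1 1) 2 * curl w x 1)| ≤ 2 * C * M := by
  refine (abs_errorDensity_le (k := fun s => ε ^ 2 / ((s ^ 2 + ε ^ 2) * Real.sqrt (s ^ 2 + ε ^ 2)))
    hcone).trans ?_
  have h1 := abs_kReg_mul_le_one hε (curl w x 2)
  have h2 : 0 ≤ 2 * C * ‖fderiv ℝ (curl w) x‖ := by positivity
  calc 2 * C * ‖fderiv ℝ (curl w) x‖ *
        |ε ^ 2 / ((curl w x 2 ^ 2 + ε ^ 2) * Real.sqrt (curl w x 2 ^ 2 + ε ^ 2)) * curl w x 2|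
      ≤ 2 * C * ‖fderiv ℝ (curl w) x‖ * 1 := mul_le_mul_of_nonneg_left h1 h2
    _ ≤ 2 * C * M := by nlinarith [norm_nonneg (fderiv ℝ (curl w) x)]

/-- Pointwise limit of the regularised error density under the cone: `E_ε(x) → 0` as `ε → 0⁺`. [folklore] -/
private theorem tendsto_errorDensity_reg {C : ℝ} {x : EuclideanSpace ℝ (Fin 3)}
    (hcone : ‖curl w x‖ ≤ C * |curl w x 2|) :
    Tendsto (fun ε : ℝ => ε ^ 2 / ((curl w x 2 ^ 2 + ε ^ 2) * Real.sqrt (curl w x 2 ^ 2 + ε ^ 2)) *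
        (fderiv ℝ (curl w) x (EuclideanSpace.single 0 1) 2 * curl w x 0
          + fderiv ℝ (curl w) x (EuclideanSpace.single 1 1) 2 * curl w x 1)) (𝓝[>] 0) (𝓝 0) := by
  refine squeeze_zero_norm (fun ε => ?_)
    (((tendsto_kReg_mul (curl w x 2)).abs).const_mul (2 * C * ‖fderiv ℝ (curl w) x‖) |>.trans_eq ?_)
  · rw [Real.norm_eq_abs]
    exact abs_errorDensity_le (k := fun s => ε ^ 2 / ((s ^ 2 + ε ^ 2) * Real.sqrt (s ^ 2 + ε ^ 2))) hcone
  · simp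

/-- The lateral term is bounded by the lateral integral of `|ω|`: for `a ≥ 0` and `|h| ≤ 1`,
`|∫₀^{2π} h(ω₃)⟪ω, e_r⟫ a dθ| ≤ ∫₀^{2π} ‖ω‖ a dθ`. [folklore] -/
private theorem abs_lateral_le (hw : ContDiff ℝ 2 w) {h : ℝ → ℝ} (hh : Continuous h) (h1 : ∀ s, |h s| ≤ 1)
    {a : ℝ} (ha : 0 ≤ a) (ζ : ℝ) :
    |∫ θ in (0 : ℝ)..(2 * Real.pi), h (curl w (meridionalPoint θ a ζ) 2) * ⟪curl w (meridionalPoint θ a ζ), meridionalPoint θ 1 0⟫_ℝ * a|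
      ≤ ∫ θ in (0 : ℝ)..(2 * Real.pi), ‖curl w (meridionalPoint θ a ζ)‖ * a := by
  have h2π : (0 : ℝ) ≤ 2 * Real.pi := by positivity
  have hωc : Continuous (curl w) := (contDiff_one_curl hw).continuous
  have hc1 : Continuous fun θ => h (curl w (meridionalPoint θ a ζ) 2) * ⟪curl w (meridionalPoint θ a ζ), meridionalPoint θ 1 0⟫_ℝ * a :=
    (((hh.comp (continuous_coord (continuous_comp_merid_theta hωc a ζ) 2)).mul
      ((continuous_comp_merid_theta hωc a ζ).inner continuous_eR)).mul continuous_const)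
  have hc2 : Continuous fun θ => ‖curl w (meridionalPoint θ a ζ)‖ * a :=
    (continuous_comp_merid_theta hωc a ζ).norm.mul continuous_const
  calc |∫ θ in (0 : ℝ)..(2 * Real.pi), h (curl w (meridionalPoint θ a ζ) 2) * ⟪curl w (meridionalPoint θ a ζ), meridionalPoint θ 1 0⟫_ℝ * a|
      ≤ ∫ θ in (0 : ℝ)..(2 * Real.pi), |h (curl w (meridionalPoint θ a ζ) 2) * ⟪curl w (meridionalPoint θ a ζ), meridionalPoint θ 1 0⟫_ℝ * a| :=
        intervalIntegral.abs_integral_le_integral_abs h2π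
    _ ≤ ∫ θ in (0 : ℝ)..(2 * Real.pi), ‖curl w (meridionalPoint θ a ζ)‖ * a := by
        refine intervalIntegral.integral_mono_on h2π (hc1.abs.intervalIntegrable _ _)
          (hc2.intervalIntegrable _ _) fun θ _ => ?_
        rw [abs_mul, abs_mul, abs_of_nonneg ha]
        refine mul_le_mul_of_nonneg_right ?_ ha
        calc |h (curl w (meridionalPoint θ a ζ) 2)| * |⟪curl w (meridionalPoint θ a ζ), meridionalPoint θ 1 0⟫_ℝ|
            ≤ 1 * (‖curl w (meridionalPoint θ a ζ)‖ * ‖meridionalPoint θ 1 0‖) :=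
              mul_le_mul (h1 _) (abs_real_inner_le_norm _ _) (abs_nonneg _) zero_le_one
          _ = ‖curl w (meridionalPoint θ a ζ)‖ := by rw [norm_eR, mul_one, one_mul]

/-- The regularised disc integral is `2π a² ε`-close to the absolute flux: for `0 ≤ a`, `0 < ε`,
`|∫₀^a∫₀^{2π} g_ε(ω₃) ρ − ∫₀^a∫₀^{2π} |ω₃| ρ| ≤ ε a (2π) a`. [folklore] -/
private theorem abs_regularisedFlux_sub_absFlux_le (hw : ContDiff ℝ 2 w) {a ε : ℝ} (ha : 0 ≤ a) (hε : 0 < ε)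
    (z : ℝ) :
    |(∫ ρ in (0 : ℝ)..a, ∫ θ in (0 : ℝ)..(2 * Real.pi), Real.sqrt (curl w (meridionalPoint θ ρ z) 2 ^ 2 + ε ^ 2) * ρ) -
        (∫ ρ in (0 : ℝ)..a, ∫ θ in (0 : ℝ)..(2 * Real.pi), |curl w (meridionalPoint θ ρ z) 2| * ρ)|
      ≤ ε * a * |2 * Real.pi - 0| * |a - 0| := by
  have hωc : Continuous (curl w) := (contDiff_one_curl hw).continuous
  have hω3 : Continuous fun q : ℝ × ℝ => curl w (meridionalPoint q.2 q.1 z) 2 :=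
    continuous_coord (continuous_comp_merid₂ hωc z) 2
  have hcg : Continuous fun q : ℝ × ℝ => Real.sqrt (curl w (meridionalPoint q.2 q.1 z) 2 ^ 2 + ε ^ 2) * q.1 :=
    (Real.continuous_sqrt.comp ((hω3.pow 2).add continuous_const)).mul continuous_fst
  have hca : Continuous fun q : ℝ × ℝ => |curl w (meridionalPoint q.2 q.1 z) 2| * q.1 := hω3.abs.mul continuous_fst
  have hIg : ∀ ρ, IntervalIntegrable (fun θ => Real.sqrt (curl w (meridionalPoint θ ρ z) 2 ^ 2 + ε ^ 2) * ρ)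
      volume 0 (2 * Real.pi) := fun ρ => (hcg.comp (continuous_const.prodMk continuous_id)).intervalIntegrable _ _
  have hIa : ∀ ρ, IntervalIntegrable (fun θ => |curl w (meridionalPoint θ ρ z) 2| * ρ) volume 0 (2 * Real.pi) :=
    fun ρ => (hca.comp (continuous_const.prodMk continuous_id)).intervalIntegrable _ _
  have hOg : IntervalIntegrable (fun ρ => ∫ θ in (0 : ℝ)..(2 * Real.pi),
      Real.sqrt (curl w (meridionalPoint θ ρ z) 2 ^ 2 + ε ^ 2) * ρ) volume 0 a :=
    (intervalIntegral.continuous_parametric_intervalIntegral_of_continuous' hcg _ _).intervalIntegrable _ _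
  have hOa : IntervalIntegrable (fun ρ => ∫ θ in (0 : ℝ)..(2 * Real.pi), |curl w (meridionalPoint θ ρ z) 2| * ρ)
      volume 0 a :=
    (intervalIntegral.continuous_parametric_intervalIntegral_of_continuous' hca _ _).intervalIntegrable _ _
  rw [← intervalIntegral.integral_sub hOg hOa,
    intervalIntegral.integral_congr (fun ρ _ => (intervalIntegral.integral_sub (hIg ρ) (hIa ρ)).symm)]
  rw [← Real.norm_eq_abs]
  refine intervalIntegral.norm_integral_le_of_norm_le_const fun ρ hρ => ?_
  refine intervalIntegral.norm_integral_le_of_norm_le_const fun θ _ => ?_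
  rw [uIoc_of_le ha] at hρ
  rw [Real.norm_eq_abs, ← sub_mul, abs_mul, abs_of_nonneg hρ.1.le]
  exact mul_le_mul (abs_gReg_sub_abs_le hε _) hρ.2 hρ.1.le hε.le

/-- **Lei–Ren–Tian 2025, §3, (3.2)–(3.3) (the `M = 0` flux bound as a pure calculus lemma).**  Let `w` be a `C²`
vector field on `ℝ³` whose vorticity `ω = curl w` satisfies the slack-free cone condition `|ω| ≤ C |ω₃|` at every
point of the solid cylinder `{(ρ cos θ, ρ sin θ, ζ) : 0 ≤ ρ ≤ a, z₁ ≤ ζ ≤ z₂}` (`a ≥ 0`, `z₁ ≤ z₂`).  Then the absolute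
vorticity fluxes `Γ(a, z) = ∫₀^a ∫₀^{2π} |ω₃(ρ cos θ, ρ sin θ, z)| ρ dθ dρ` through the two lids satisfy
`|Γ(a, z₂) − Γ(a, z₁)| ≤ ∫_{z₁}^{z₂} ∫₀^{2π} |ω(a cos θ, a sin θ, ζ)| a dθ dζ` — the flipped vorticity
`ω̃ = sgn(ω₃) ω` is divergence free, so the flux only changes through the lateral boundary.  (The field is
taken globally `C²` for convenience; a field smooth only on an open neighbourhood of the solid cylinder is first
multiplied by a smooth cut-off equal to `1` near the cylinder — hypotheses and conclusion only see the cylinder.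
`ω₃ = (curl w x) 2 = ⟪curl w x, eZ⟫`.)
-- TODO(general form): the printed (3.3) also records the consequence `sup_z ∫_{D(1/2,z)} |ω| ≤ G^{O(G)}` given a
-- regular shell; that step needs only this lemma, the cone, and first-derivative bounds of `v` on the shell.
[cite: LeiRenTian2025, §3 (3.2)–(3.3) (arXiv:2501.08976, p. 8)] -/
theorem absFlux_sub_absFlux_le (hw : ContDiff ℝ 2 w) {C a z₁ z₂ : ℝ} (ha : 0 ≤ a) (hz : z₁ ≤ z₂)
    (hcone : ∀ ρ ∈ Icc (0 : ℝ) a, ∀ θ : ℝ, ∀ ζ ∈ Icc z₁ z₂,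
      ‖curl w (meridionalPoint θ ρ ζ)‖ ≤ C * |curl w (meridionalPoint θ ρ ζ) 2|) :
    |(∫ ρ in (0 : ℝ)..a, ∫ θ in (0 : ℝ)..(2 * Real.pi), |curl w (meridionalPoint θ ρ z₂) 2| * ρ) -
        (∫ ρ in (0 : ℝ)..a, ∫ θ in (0 : ℝ)..(2 * Real.pi), |curl w (meridionalPoint θ ρ z₁) 2| * ρ)|
      ≤ ∫ ζ in z₁..z₂, ∫ θ in (0 : ℝ)..(2 * Real.pi), ‖curl w (meridionalPoint θ a ζ)‖ * a := by
  -- WLOG `C ≥ 0`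
  set C' := max C 0 with hC'
  have hC'0 : 0 ≤ C' := le_max_right _ _
  have hcone' : ∀ ρ ∈ Icc (0 : ℝ) a, ∀ θ : ℝ, ∀ ζ ∈ Icc z₁ z₂,
      ‖curl w (meridionalPoint θ ρ ζ)‖ ≤ C' * |curl w (meridionalPoint θ ρ ζ) 2| := fun ρ hρ θ ζ hζ =>
    (hcone ρ hρ θ ζ hζ).trans (mul_le_mul_of_nonneg_right (le_max_left _ _) (abs_nonneg _))
  have hω := contDiff_one_curl hw
  have hωc : Continuous (curl w) := hω.continuous
  have hDc : Continuous (fderiv ℝ (curl w)) := hω.continuous_fderiv one_ne_zero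
  have h2π : (0 : ℝ) ≤ 2 * Real.pi := by positivity
  -- a uniform bound `M` for `‖Dω‖` on the solid cylinder
  obtain ⟨M, hM⟩ : ∃ M, ∀ q ∈ Icc (0 : ℝ) a ×ˢ (Icc (0 : ℝ) (2 * Real.pi) ×ˢ Icc z₁ z₂),
      ‖fderiv ℝ (curl w) (meridionalPoint q.2.1 q.1 q.2.2)‖ ≤ M :=
    (isCompact_Icc.prod (isCompact_Icc.prod isCompact_Icc)).exists_bound_of_continuousOn
      ((hDc.comp continuous_merid₃).continuousOn)
  -- notation for the regularised error density
  set E : ℝ → EuclideanSpace ℝ (Fin 3) → ℝ := fun ε x =>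
    ε ^ 2 / ((curl w x 2 ^ 2 + ε ^ 2) * Real.sqrt (curl w x 2 ^ 2 + ε ^ 2)) *
      (fderiv ℝ (curl w) x (EuclideanSpace.single 0 1) 2 * curl w x 0
        + fderiv ℝ (curl w) x (EuclideanSpace.single 1 1) 2 * curl w x 1) with hE
  have hEc : ∀ {ε : ℝ}, ε ≠ 0 → Continuous (E ε) := fun {ε} hε =>
    continuous_errorDensity hw (continuous_kReg hε)
  -- the uniform bound `B` on the box and the pointwise limit
  set B : ℝ := 2 * C' * M * a with hB
  have hbound : ∀ {ε : ℝ}, ε ≠ 0 → ∀ ρ ∈ Icc (0 : ℝ) a, ∀ θ ∈ Icc (0 : ℝ) (2 * Real.pi), ∀ ζ ∈ Icc z₁ z₂,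
      |E ε (meridionalPoint θ ρ ζ) * ρ| ≤ B := by
    intro ε hε ρ hρ θ hθ ζ hζ
    rw [abs_mul, abs_of_nonneg hρ.1, hB]
    have h1 := abs_errorDensity_reg_le hC'0 hε (hcone' ρ hρ θ ζ hζ) (hM (ρ, θ, ζ) ⟨hρ, hθ, hζ⟩)
    have hM0 : 0 ≤ 2 * C' * M := le_trans (abs_nonneg _) h1
    exact mul_le_mul h1 hρ.2 hρ.1 hM0
  have hlim : ∀ ρ ∈ Icc (0 : ℝ) a, ∀ θ : ℝ, ∀ ζ ∈ Icc z₁ z₂,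
      Tendsto (fun ε => E ε (meridionalPoint θ ρ ζ) * ρ) (𝓝[>] 0) (𝓝 0) := by
    intro ρ hρ θ ζ hζ
    simpa using (tendsto_errorDensity_reg (hcone' ρ hρ θ ζ hζ)).mul_const ρ
  have hpos : ∀ᶠ ε in 𝓝[>] (0 : ℝ), 0 < ε := eventually_nhdsWithin_of_forall fun ε hε => hε
  -- Level θ
  have hT1 : ∀ ρ ∈ Icc (0 : ℝ) a, ∀ ζ ∈ Icc z₁ z₂,
      Tendsto (fun ε => ∫ θ in (0 : ℝ)..(2 * Real.pi), E ε (meridionalPoint θ ρ ζ) * ρ) (𝓝[>] 0) (𝓝 0) := by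
    intro ρ hρ ζ hζ
    have h := intervalIntegral.tendsto_integral_filter_of_dominated_convergence (μ := volume)
      (a := (0 : ℝ)) (b := 2 * Real.pi) (l := 𝓝[>] (0 : ℝ))
      (F := fun ε θ => E ε (meridionalPoint θ ρ ζ) * ρ) (f := fun _ => (0 : ℝ)) (fun _ => B) ?_ ?_
      intervalIntegrable_const ?_
    · simpa using h
    · filter_upwards [hpos] with ε hε
      exact ((continuous_comp_merid_theta (hEc hε.ne') ρ ζ).mul continuous_const).aestronglyMeasurable
    · filter_upwards [hpos] with ε hε
      refine Eventually.of_forall fun θ hθ => ?_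
      rw [uIoc_of_le h2π] at hθ
      rw [Real.norm_eq_abs]
      exact hbound hε.ne' ρ hρ θ ⟨hθ.1.le, hθ.2⟩ ζ hζ
    · exact Eventually.of_forall fun θ _ => hlim ρ hρ θ ζ hζ
  -- Level ρ
  have hT2 : ∀ ζ ∈ Icc z₁ z₂,
      Tendsto (fun ε => ∫ ρ in (0 : ℝ)..a, ∫ θ in (0 : ℝ)..(2 * Real.pi), E ε (meridionalPoint θ ρ ζ) * ρ)
        (𝓝[>] 0) (𝓝 0) := by
    intro ζ hζ
    have h := intervalIntegral.tendsto_integral_filter_of_dominated_convergence (μ := volume)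
      (a := (0 : ℝ)) (b := a) (l := 𝓝[>] (0 : ℝ))
      (F := fun ε ρ => ∫ θ in (0 : ℝ)..(2 * Real.pi), E ε (meridionalPoint θ ρ ζ) * ρ) (f := fun _ => (0 : ℝ))
      (fun _ => B * |2 * Real.pi - 0|) ?_ ?_ intervalIntegrable_const ?_
    · simpa using h
    · filter_upwards [hpos] with ε hε
      exact (intervalIntegral.continuous_parametric_intervalIntegral_of_continuous'
        ((continuous_comp_merid₂ (hEc hε.ne') ζ).mul continuous_fst) _ _).aestronglyMeasurable
    · filter_upwards [hpos] with ε hε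
      refine Eventually.of_forall fun ρ hρ => ?_
      rw [uIoc_of_le ha] at hρ
      refine intervalIntegral.norm_integral_le_of_norm_le_const fun θ hθ => ?_
      rw [uIoc_of_le h2π] at hθ
      rw [Real.norm_eq_abs]
      exact hbound hε.ne' ρ ⟨hρ.1.le, hρ.2⟩ θ ⟨hθ.1.le, hθ.2⟩ ζ hζ
    · refine Eventually.of_forall fun ρ hρ => ?_
      rw [uIoc_of_le ha] at hρ
      exact hT1 ρ ⟨hρ.1.le, hρ.2⟩ ζ hζ
  -- Level ζ
  have hT3 : Tendsto (fun ε => ∫ ζ in z₁..z₂, ∫ ρ in (0 : ℝ)..a, ∫ θ in (0 : ℝ)..(2 * Real.pi),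
      E ε (meridionalPoint θ ρ ζ) * ρ) (𝓝[>] 0) (𝓝 0) := by
    have h := intervalIntegral.tendsto_integral_filter_of_dominated_convergence (μ := volume)
      (a := z₁) (b := z₂) (l := 𝓝[>] (0 : ℝ))
      (F := fun ε ζ => ∫ ρ in (0 : ℝ)..a, ∫ θ in (0 : ℝ)..(2 * Real.pi), E ε (meridionalPoint θ ρ ζ) * ρ)
      (f := fun _ => (0 : ℝ)) (fun _ => B * |2 * Real.pi - 0| * |a - 0|) ?_ ?_ intervalIntegrable_const ?_
    · simpa using h
    · filter_upwards [hpos] with ε hε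
      have hG : Continuous (Function.uncurry fun (ζ ρ : ℝ) => ∫ θ in (0 : ℝ)..(2 * Real.pi),
          E ε (meridionalPoint θ ρ ζ) * ρ) := by
        have hf : Continuous (Function.uncurry fun (p : ℝ × ℝ) (θ : ℝ) => E ε (meridionalPoint θ p.2 p.1) * p.2) :=
          (((hEc hε.ne').comp continuous_merid₃).comp
            (continuous_fst.snd.prodMk (continuous_snd.prodMk continuous_fst.fst))).mul continuous_fst.snd
        exact intervalIntegral.continuous_parametric_intervalIntegral_of_continuous' hf _ _
      exact (intervalIntegral.continuous_parametric_intervalIntegral_of_continuous' hG _ _).aestronglyMeasurable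
    · filter_upwards [hpos] with ε hε
      refine Eventually.of_forall fun ζ hζ => ?_
      rw [uIoc_of_le hz] at hζ
      refine intervalIntegral.norm_integral_le_of_norm_le_const fun ρ hρ => ?_
      rw [uIoc_of_le ha] at hρ
      refine intervalIntegral.norm_integral_le_of_norm_le_const fun θ hθ => ?_
      rw [uIoc_of_le h2π] at hθ
      rw [Real.norm_eq_abs]
      exact hbound hε.ne' ρ ⟨hρ.1.le, hρ.2⟩ θ ⟨hθ.1.le, hθ.2⟩ ζ ⟨hζ.1.le, hζ.2⟩
    · refine Eventually.of_forall fun ζ hζ => ?_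
      rw [uIoc_of_le hz] at hζ
      exact hT2 ζ ⟨hζ.1.le, hζ.2⟩
  -- the lateral integrals
  have hLat : ∀ {ε : ℝ}, 0 < ε → ∀ ζ, |∫ θ in (0 : ℝ)..(2 * Real.pi),
      (curl w (meridionalPoint θ a ζ) 2 / Real.sqrt (curl w (meridionalPoint θ a ζ) 2 ^ 2 + ε ^ 2)) *
        ⟪curl w (meridionalPoint θ a ζ), meridionalPoint θ 1 0⟫_ℝ * a| ≤ ∫ θ in (0 : ℝ)..(2 * Real.pi), ‖curl w (meridionalPoint θ a ζ)‖ * a :=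
    fun {ε} hε ζ => abs_lateral_le hw (h := fun s => s / Real.sqrt (s ^ 2 + ε ^ 2))
      (contDiff_hReg hε.ne' (n := 0)).continuous (abs_hReg_le_one hε.ne') ha ζ
  have hLatc : Continuous fun ζ => ∫ θ in (0 : ℝ)..(2 * Real.pi), ‖curl w (meridionalPoint θ a ζ)‖ * a := by
    refine intervalIntegral.continuous_parametric_intervalIntegral_of_continuous' ?_ _ _
    exact ((hωc.comp (continuous_merid₃.comp (continuous_const.prodMk
      (continuous_snd.prodMk continuous_fst)))).norm).mul continuous_const
  -- the estimate at level `ε > 0`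
  have hmain : ∀ᶠ ε in 𝓝[>] (0 : ℝ),
      |(∫ ρ in (0 : ℝ)..a, ∫ θ in (0 : ℝ)..(2 * Real.pi), |curl w (meridionalPoint θ ρ z₂) 2| * ρ) -
          (∫ ρ in (0 : ℝ)..a, ∫ θ in (0 : ℝ)..(2 * Real.pi), |curl w (meridionalPoint θ ρ z₁) 2| * ρ)|
        ≤ 2 * (ε * a * |2 * Real.pi - 0| * |a - 0|) +
          |∫ ζ in z₁..z₂, ∫ ρ in (0 : ℝ)..a, ∫ θ in (0 : ℝ)..(2 * Real.pi), E ε (meridionalPoint θ ρ ζ) * ρ| +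
          ∫ ζ in z₁..z₂, ∫ θ in (0 : ℝ)..(2 * Real.pi), ‖curl w (meridionalPoint θ a ζ)‖ * a := by
    filter_upwards [hpos] with ε hε
    have hε' : ε ≠ 0 := hε.ne'
    -- the identity for `g_ε`
    have hid := regularisedFlux_sub_eq hw (g := fun s => Real.sqrt (s ^ 2 + ε ^ 2))
      (h := fun s => s / Real.sqrt (s ^ 2 + ε ^ 2))
      (k := fun s => ε ^ 2 / ((s ^ 2 + ε ^ 2) * Real.sqrt (s ^ 2 + ε ^ 2)))
      (hasDerivAt_gReg hε') (hasDerivAt_hReg hε') (contDiff_hReg hε') (continuous_kReg hε') a z₁ z₂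
    have hc2 := abs_regularisedFlux_sub_absFlux_le hw ha hε z₂
    have hc1 := abs_regularisedFlux_sub_absFlux_le hw ha hε z₁
    -- continuity of the two `ζ`-integrands, for `integral_sub`
    have hRc : Continuous fun ζ => ∫ ρ in (0 : ℝ)..a, ∫ θ in (0 : ℝ)..(2 * Real.pi), E ε (meridionalPoint θ ρ ζ) * ρ := by
      have hG : Continuous (Function.uncurry fun (ζ ρ : ℝ) => ∫ θ in (0 : ℝ)..(2 * Real.pi),
          E ε (meridionalPoint θ ρ ζ) * ρ) := by
        have hf : Continuous (Function.uncurry fun (p : ℝ × ℝ) (θ : ℝ) => E ε (meridionalPoint θ p.2 p.1) * p.2) :=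
          (((hEc hε').comp continuous_merid₃).comp
            (continuous_fst.snd.prodMk (continuous_snd.prodMk continuous_fst.fst))).mul continuous_fst.snd
        exact intervalIntegral.continuous_parametric_intervalIntegral_of_continuous' hf _ _
      exact intervalIntegral.continuous_parametric_intervalIntegral_of_continuous' hG _ _
    have hHc : Continuous fun ζ => ∫ θ in (0 : ℝ)..(2 * Real.pi),
        (curl w (meridionalPoint θ a ζ) 2 / Real.sqrt (curl w (meridionalPoint θ a ζ) 2 ^ 2 + ε ^ 2)) *
          ⟪curl w (meridionalPoint θ a ζ), meridionalPoint θ 1 0⟫_ℝ * a := by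
      refine intervalIntegral.continuous_parametric_intervalIntegral_of_continuous' ?_ _ _
      have hP : Continuous fun q : ℝ × ℝ => meridionalPoint q.2 a q.1 :=
        continuous_merid₃.comp (continuous_const.prodMk (continuous_snd.prodMk continuous_fst))
      have hωP : Continuous fun q : ℝ × ℝ => curl w (meridionalPoint q.2 a q.1) := hωc.comp hP
      exact ((((contDiff_hReg hε' (n := 0)).continuous).comp (continuous_coord hωP 2)).mul
        (hωP.inner (continuous_eR.comp continuous_snd))).mul continuous_const
    have hsub : ∫ ζ in z₁..z₂, ((∫ ρ in (0 : ℝ)..a, ∫ θ in (0 : ℝ)..(2 * Real.pi), E ε (meridionalPoint θ ρ ζ) * ρ) -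
        ∫ θ in (0 : ℝ)..(2 * Real.pi), (curl w (meridionalPoint θ a ζ) 2 / Real.sqrt (curl w (meridionalPoint θ a ζ) 2 ^ 2 + ε ^ 2)) *
          ⟪curl w (meridionalPoint θ a ζ), meridionalPoint θ 1 0⟫_ℝ * a) =
        (∫ ζ in z₁..z₂, ∫ ρ in (0 : ℝ)..a, ∫ θ in (0 : ℝ)..(2 * Real.pi), E ε (meridionalPoint θ ρ ζ) * ρ) -
          ∫ ζ in z₁..z₂, ∫ θ in (0 : ℝ)..(2 * Real.pi),
            (curl w (meridionalPoint θ a ζ) 2 / Real.sqrt (curl w (meridionalPoint θ a ζ) 2 ^ 2 + ε ^ 2)) *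
              ⟪curl w (meridionalPoint θ a ζ), meridionalPoint θ 1 0⟫_ℝ * a :=
      intervalIntegral.integral_sub (hRc.intervalIntegrable _ _) (hHc.intervalIntegrable _ _)
    have hHbound : |∫ ζ in z₁..z₂, ∫ θ in (0 : ℝ)..(2 * Real.pi),
        (curl w (meridionalPoint θ a ζ) 2 / Real.sqrt (curl w (meridionalPoint θ a ζ) 2 ^ 2 + ε ^ 2)) *
          ⟪curl w (meridionalPoint θ a ζ), meridionalPoint θ 1 0⟫_ℝ * a| ≤
        ∫ ζ in z₁..z₂, ∫ θ in (0 : ℝ)..(2 * Real.pi), ‖curl w (meridionalPoint θ a ζ)‖ * a := by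
      refine (intervalIntegral.abs_integral_le_integral_abs hz).trans ?_
      exact intervalIntegral.integral_mono_on hz (hHc.abs.intervalIntegrable _ _)
        (hLatc.intervalIntegrable _ _) fun ζ _ => hLat hε ζ
    -- assemble: Γ₂ − Γ₁ = (Γ₂ − G₂) + (G₂ − G₁) + (G₁ − Γ₁)
    have key : (∫ ρ in (0 : ℝ)..a, ∫ θ in (0 : ℝ)..(2 * Real.pi), |curl w (meridionalPoint θ ρ z₂) 2| * ρ) -
        (∫ ρ in (0 : ℝ)..a, ∫ θ in (0 : ℝ)..(2 * Real.pi), |curl w (meridionalPoint θ ρ z₁) 2| * ρ) =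
        -((∫ ρ in (0 : ℝ)..a, ∫ θ in (0 : ℝ)..(2 * Real.pi), Real.sqrt (curl w (meridionalPoint θ ρ z₂) 2 ^ 2 + ε ^ 2) * ρ) -
            (∫ ρ in (0 : ℝ)..a, ∫ θ in (0 : ℝ)..(2 * Real.pi), |curl w (meridionalPoint θ ρ z₂) 2| * ρ)) +
          ((∫ ζ in z₁..z₂, ∫ ρ in (0 : ℝ)..a, ∫ θ in (0 : ℝ)..(2 * Real.pi), E ε (meridionalPoint θ ρ ζ) * ρ) -
            ∫ ζ in z₁..z₂, ∫ θ in (0 : ℝ)..(2 * Real.pi),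
              (curl w (meridionalPoint θ a ζ) 2 / Real.sqrt (curl w (meridionalPoint θ a ζ) 2 ^ 2 + ε ^ 2)) *
                ⟪curl w (meridionalPoint θ a ζ), meridionalPoint θ 1 0⟫_ℝ * a) +
          ((∫ ρ in (0 : ℝ)..a, ∫ θ in (0 : ℝ)..(2 * Real.pi), Real.sqrt (curl w (meridionalPoint θ ρ z₁) 2 ^ 2 + ε ^ 2) * ρ) -
            (∫ ρ in (0 : ℝ)..a, ∫ θ in (0 : ℝ)..(2 * Real.pi), |curl w (meridionalPoint θ ρ z₁) 2| * ρ)) := by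
      rw [← hsub, ← hid]
      ring
    rw [key]
    refine (abs_add_le _ _).trans ((add_le_add (abs_add_le _ _) le_rfl).trans ?_)
    rw [abs_neg]
    have h3 : |(∫ ζ in z₁..z₂, ∫ ρ in (0 : ℝ)..a, ∫ θ in (0 : ℝ)..(2 * Real.pi), E ε (meridionalPoint θ ρ ζ) * ρ) -
        ∫ ζ in z₁..z₂, ∫ θ in (0 : ℝ)..(2 * Real.pi),
          (curl w (meridionalPoint θ a ζ) 2 / Real.sqrt (curl w (meridionalPoint θ a ζ) 2 ^ 2 + ε ^ 2)) *
            ⟪curl w (meridionalPoint θ a ζ), meridionalPoint θ 1 0⟫_ℝ * a| ≤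
        |∫ ζ in z₁..z₂, ∫ ρ in (0 : ℝ)..a, ∫ θ in (0 : ℝ)..(2 * Real.pi), E ε (meridionalPoint θ ρ ζ) * ρ| +
          ∫ ζ in z₁..z₂, ∫ θ in (0 : ℝ)..(2 * Real.pi), ‖curl w (meridionalPoint θ a ζ)‖ * a :=
      (abs_sub _ _).trans (add_le_add le_rfl hHbound)
    linarith [hc1, hc2, h3]
  -- pass to the limit `ε → 0⁺`
  have hlimit : Tendsto (fun ε : ℝ => 2 * (ε * a * |2 * Real.pi - 0| * |a - 0|) +
      |∫ ζ in z₁..z₂, ∫ ρ in (0 : ℝ)..a, ∫ θ in (0 : ℝ)..(2 * Real.pi), E ε (meridionalPoint θ ρ ζ) * ρ| +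
      ∫ ζ in z₁..z₂, ∫ θ in (0 : ℝ)..(2 * Real.pi), ‖curl w (meridionalPoint θ a ζ)‖ * a) (𝓝[>] 0)
      (𝓝 (2 * (0 * a * |2 * Real.pi - 0| * |a - 0|) + |0| +
        ∫ ζ in z₁..z₂, ∫ θ in (0 : ℝ)..(2 * Real.pi), ‖curl w (meridionalPoint θ a ζ)‖ * a)) := by
    have hεt : Tendsto (fun ε : ℝ => ε) (𝓝[>] (0 : ℝ)) (𝓝 0) :=
      tendsto_id.mono_left nhdsWithin_le_nhds
    exact ((((hεt.mul_const a).mul_const _).mul_const _).const_mul 2).add hT3.abs |>.add tendsto_const_nhds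
  have := ge_of_tendsto hlimit hmain
  simpa using this


/-- **The `M = 0` flux bound with a regular shell ((3.3), the shape consumed as (4.1)).**  Under the slack-free cone
on the solid cylinder `{0 ≤ ρ ≤ a, z₁ ≤ ζ ≤ z₂}` and a pointwise bound `‖ω‖ ≤ B` on its top lid `ζ = z₂` and on its
lateral surface `ρ = a` (in the paper: the lid and the lateral surface lie in a regular shell, where
`|ω| ≤ |∇v| ≤ G^{O(G)}`), the absolute flux through the bottom lid obeys
`Γ(a, z₁) ≤ B a · 2π · a + B a · 2π · (z₂ − z₁)` — uniformly in `z₁`, first derivatives of `v` only.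
[cite: LeiRenTian2025, §3 (3.3) (arXiv:2501.08976, p. 8)] -/
theorem absFlux_le_of_shell_bounds (hw : ContDiff ℝ 2 w) {C a z₁ z₂ B : ℝ} (ha : 0 ≤ a) (hz : z₁ ≤ z₂)
    (hcone : ∀ ρ ∈ Icc (0 : ℝ) a, ∀ θ : ℝ, ∀ ζ ∈ Icc z₁ z₂,
      ‖curl w (meridionalPoint θ ρ ζ)‖ ≤ C * |curl w (meridionalPoint θ ρ ζ) 2|)
    (htop : ∀ ρ ∈ Icc (0 : ℝ) a, ∀ θ : ℝ, ‖curl w (meridionalPoint θ ρ z₂)‖ ≤ B)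
    (hlat : ∀ θ : ℝ, ∀ ζ ∈ Icc z₁ z₂, ‖curl w (meridionalPoint θ a ζ)‖ ≤ B) :
    (∫ ρ in (0 : ℝ)..a, ∫ θ in (0 : ℝ)..(2 * Real.pi), |curl w (meridionalPoint θ ρ z₁) 2| * ρ)
      ≤ B * a * |2 * Real.pi - 0| * |a - 0| + B * a * |2 * Real.pi - 0| * |z₂ - z₁| := by
  have h2π : (0 : ℝ) ≤ 2 * Real.pi := by positivity
  have hmain := absFlux_sub_absFlux_le hw ha hz hcone
  -- the top lid
  have htopI : |∫ ρ in (0 : ℝ)..a, ∫ θ in (0 : ℝ)..(2 * Real.pi), |curl w (meridionalPoint θ ρ z₂) 2| * ρ|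
      ≤ B * a * |2 * Real.pi - 0| * |a - 0| := by
    rw [← Real.norm_eq_abs]
    refine intervalIntegral.norm_integral_le_of_norm_le_const fun ρ hρ => ?_
    rw [uIoc_of_le ha] at hρ
    refine intervalIntegral.norm_integral_le_of_norm_le_const fun θ _ => ?_
    rw [Real.norm_eq_abs, abs_mul, abs_abs, abs_of_nonneg hρ.1.le]
    have h1 : |curl w (meridionalPoint θ ρ z₂) 2| ≤ B :=
      (by simpa using PiLp.norm_apply_le (curl w (meridionalPoint θ ρ z₂)) 2 :
        |curl w (meridionalPoint θ ρ z₂) 2| ≤ ‖curl w (meridionalPoint θ ρ z₂)‖).trans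
        (htop ρ ⟨hρ.1.le, hρ.2⟩ θ)
    have hB : 0 ≤ B := (norm_nonneg _).trans (htop ρ ⟨hρ.1.le, hρ.2⟩ θ)
    exact mul_le_mul h1 hρ.2 hρ.1.le hB
  -- the lateral surface
  have hlatI : |∫ ζ in z₁..z₂, ∫ θ in (0 : ℝ)..(2 * Real.pi), ‖curl w (meridionalPoint θ a ζ)‖ * a|
      ≤ B * a * |2 * Real.pi - 0| * |z₂ - z₁| := by
    rw [← Real.norm_eq_abs]
    refine intervalIntegral.norm_integral_le_of_norm_le_const fun ζ hζ => ?_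
    rw [uIoc_of_le hz] at hζ
    refine intervalIntegral.norm_integral_le_of_norm_le_const fun θ _ => ?_
    rw [Real.norm_eq_abs, abs_mul, abs_norm, abs_of_nonneg ha]
    exact mul_le_mul_of_nonneg_right (hlat θ ζ ⟨hζ.1.le, hζ.2⟩) ha
  have h1 := (le_abs_self _).trans htopI
  have h2 := (le_abs_self _).trans hlatI
  have h3 := (neg_le_abs _).trans hmain
  linarith

end Main


end Literature.Analysis.FluidPDE.LeiRenTian2025.FlippedVorticity

end
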